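import Literature.AlgebraicGeometry.Resolution.AlterationsRationalMapExtension
import Literature.AlgebraicGeometry.Resolution.AlterationsStrictTransformHolds
import Literature.AlgebraicGeometry.Resolution.AlterationsGraphClosure
import Literature.AlgebraicGeometry.Resolution.StrictTransformFlattening
import Literature.AlgebraicGeometry.Resolution.StrictTransformFlatLocus
import Literature.AlgebraicGeometry.Resolution.StrictTransformModificationProofs
import Literature.AlgebraicGeometry.Resolution.AlterationsGraphClosureFiniteFibresProofs
import Literature.AlgebraicGeometry.Resolution.AlterationsNormalizationReduction
import Literature.AlgebraicGeometry.Resolution.BaseChangeOverOpens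
import Literature.AlgebraicGeometry.Resolution.ComponentsUnderIntegralFlat
import Literature.AlgebraicGeometry.Resolution.FibresOfBaseChange
import HarnessLib

/-!
# De Jong 1996, 4.18 (the reduction to flat `X`, `T` over a normal base) PROVED:
# `DeJong1996RationalMapExtension` from Raynaud–Gruson's flattening theorem (`Stacks081R`)

Topic: `Literature/AlgebraicGeometry/Resolution`. Companion of `AlterationsRationalMapExtension.lean`,
whose named fact `DeJong1996RationalMapExtension` is de Jong 1996, 4.18–4.21 ("after replacing
`S` by a modification, the rational map `β` extends to a morphism `𝒞' → X'`", pp. 72–74). Of its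
printed proof the tree already PROVES 4.19–4.21 unconditionally
(`DeJong1996.ThreePointSituation.exists_extension'`, `AlterationsGraphClosureFiniteFibresProofs.lean`:
in Situation 4.18 a)–c), e), g) over an integral Noetherian base `S` with h) `X` and `T` flat over
`S` and i) `S` normal, `β` extends), 2.18 (`DeJong1996StrictTransformFlatLocus_holds`,
`DeJong1996StrictTransformModification_holds`, `strictTransform_unique`) and 2.19 from
Raynaud–Gruson (`StrictTransformFlattening.lean`, conditional on the single named fact
`Stacks081R`), and has the normalisation of a projective variety
(`AlterationsNormalizationReduction.lean`). What remains of 4.18–4.21 is therefore the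
reduction paragraph of 4.18 itself:

> "Let `S' → S` be a modification and apply the reasoning of 4.15. This gives a new set of data
> `X', σ'ᵢ, 𝒞', τ'ᵢ, β'` over the scheme `S'` satisfying the properties a)–c), e) and g). We
> remark that `X'` is the strict transform of `X`, see 2.18. Similarly, the closed subscheme
> `T' ⊂ 𝒞' ×_{S'} X' ⊂ (𝒞 ×_S X) ×_S S'` is the strict transform of `T` with respect to
> `S' → S`. Therefore, by [22], see 2.19, we may assume in addition to a)–c), e) and g) that we
> have h) Both `X` and `T`, defined as above, are flat over `S`. This condition is also stable
> under further modifications of `S`. Thus we may normalize `S` and assume that i) The scheme `S`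
> is normal." (pp. 72–73)

This file PROVES that paragraph and assembles
`DeJong1996RationalMapExtension.of_stacks081R : Stacks081R → DeJong1996RationalMapExtension`
(and with it `DeJong1996ThreePointExtension`, `DeJong1996ModelExtensionReduction`,
`DeJong1996StableModelToMorphism`, `DeJong1996StableModelToPreSemiStablePair` from `Stacks081R`,
4.15 being proved): the node 4.18–4.22a of the decomposition of de Jong's Thm. 4.1 rests on
Raynaud–Gruson's flattening theorem (Stacks 081R) alone. First, **"`X'` [the reduction of
`X ×_S S'`, 4.15] is the strict transform of `X`, see 2.18"**, in the form the transport lemmas of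
`AlterationsStrictTransformProofs.lean` consume: the closed immersion `X' ↪ X ×_S S'` of the strict transform of 2.18
(`strictTransformι`, `StrictTransform.lean`) is SURJECTIVE as soon as the smooth locus of `f` is
dense in every fibre (4.18 b)):

* `pullback_snd_apply_eq_genericPoint_of_mem_genericPoints` — every generic point of an
  irreducible component of `X ×_S S'` lies over the generic point of `S'`: it is a generic point
  of a component of its fibre, the trace of `pr_X⁻¹(sm(X/S))` on that fibre is a dense open (the
  preimage of a dense open under the flat comparison map to the fibre of `f`,
  `exists_fiber_snd_flat_surjective`, `dense_preimage_of_flat`), so the point lies in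
  `pr_X⁻¹(sm(X/S))`, over which `pr_{S'}` is smooth
  (`DeJong1996.StrictTransform.smooth_ι_preimage_smoothLocus_comp_snd`), hence flat and
  generizing (`Flat.generalizingMap`);
* `surjective_strictTransformι` — hence `X ×_S S'` is the closure of its generic fibre, which is
  the support of the strict transform (`range_strictTransformι`).

So the 4.15-type transport of a)–c), e) along any surjective closed immersion
`ι : X' → X ×_S S'` from a reduced scheme (`DeJong1996.StrictTransform.geometricallyConnected_comp_snd`,
`…topologicalKrullDim_fiber_comp_snd`, `…dense_preimage_smoothLocus_comp_snd`,
`…smooth_fiberToSpecResidueField_genericPoint_comp_snd`, `…hasThreeSmoothPoints`,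
`…isIntegral`) applies to the flat strict transform produced by 2.19.

And it proves the remark **"This condition [h), flatness of the strict transforms] is also
stable under further modifications of `S`"** as the tower property of the strict transform of
2.18, which lets all the modifications of 4.18 (flattening `X`, flattening `T`, normalising) be
composed into ONE modification `S₃ → S` before Situation 4.18 is transported:

* `strictTransformPullbackComparison f ψ₁ χ : X₁ ×_{S₁} S₂ → X ×_S S₂` — the base change of the
  strict transform `X₁ ↪ X ×_S S₁` (along `ψ₁ : S₁ → S`) to `S₂ → S₁`, a closed immersion over
  `S₂` and over `X`, an isomorphism over `(χ ≫ ψ₁)⁻¹(U)` for `U ⊆ S` an open over which `f` is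
  flat (`isIso_strictTransformPullbackComparison_morphismRestrict`, from 2.18
  `DeJong1996StrictTransformFlatLocus_holds`);
* `flat_strictTransformMap_comp` — if the strict transform along `χ : S₂ → S₁` of the strict
  transform `X₁ → S₁` is flat, so is the strict transform of `f` along `χ ≫ ψ₁`: the former is a
  closed subscheme of `X ×_S S₂`, flat over `S₂` and equal to `X ×_S S₂` over `(χ ≫ ψ₁)⁻¹(U)`,
  hence isomorphic to the latter by the uniqueness clause of 2.18 (`strictTransform_unique`);
  `flat_strictTransformMap_of_flat` — the strict transform of a flat morphism is flat (it is the
  base change).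

And it carries out **"apply the reasoning of 4.15. This gives a new set of data `X', σ'ᵢ, 𝒞',
τ'ᵢ, β'` over the scheme `S'` satisfying the properties a)–c), e) and g)"**:

* `DeJong1996.modelBaseChange` — the base change of the model isomorphism `β : 𝒞_U ⥲ X_U` along
  `ψ`, an isomorphism `(𝒞 ×_S S')|_{ψ⁻¹U} ⥲ (X ×_S S')|_{ψ⁻¹U}` (both sides are
  `X_U ×_U ψ⁻¹(U)`, `isPullback_resLE_preimage`); `DeJong1996.transportβ` — followed by the
  inverse of `ι` over `ψ⁻¹(U)`, the model isomorphism `β'` for the strict transform ("(vi) g) is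
  preserved by operations as in 4.15, by putting `𝒞' = 𝒞 ×_Y Y'`", 4.17), with its
  compatibilities (`transportβ_comm`, `transportβ_ι_ι_fst`, `transportβ_fac`);
* `DeJong1996.ThreePointSituation.transport` — Situation 4.18 for the transported data
  `(f' = ι ≫ pr_{S'}, σ'ᵢ, 𝒞 ×_S S', τ'ᵢ, ψ⁻¹U, β')`, for `ψ` dominant and surjective from an
  integral `S'`, `ι : X' → X ×_S S'` a surjective closed immersion from a reduced scheme which
  is an isomorphism over `ψ⁻¹(U)`, and `𝒞 ×_S S'` integral.

Then **"the closed subscheme `T' ⊂ 𝒞' ×_{S'} X' ⊂ (𝒞 ×_S X) ×_S S'` is the strict transform of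
`T` with respect to `S' → S`"**: for the transported data, the closure `T'` of the graph of `β'`
and the strict transform `T^{st}` (2.18) of `T → S` along `ψ` are REDUCED closed subschemes
(`T'` as the closure of the integral `𝒞'|_{ψ⁻¹U}`; `T^{st}` as the closure of the generic fibre of
`T ×_S S'`, which embeds flatly into `(T ×_S S')|_{ψ⁻¹U} ≅ 𝒞'|_{ψ⁻¹U}`,
`isReduced_strictTransform_graphClosureMap`) which map into each other
(`strictTransformToGraphClosureTransport`: on the dense part over `ψ⁻¹(U)` the morphism
`T^{st} → 𝒞' ×_{S'} X'` factors through the graph of `β'`, since on `T` over `U`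
`pr₂ = β ∘ pr₁` (`ι_graphClosureSnd_eq`); `graphClosureTransportToStrictTransform`: `T' → T ×_S S'`
sends the generic point of the graph to the generic fibre), inversely to each other
(`…_comp`); so `T' → S'` is flat once `T^{st} → S'` is
(`ThreePointSituation.flat_graphClosureMap_transport`).

Finally the assembly `DeJong1996RationalMapExtension.of_stacks081R`: `f` and `T → S` are flat
over `U` (there both are `𝒞_U`); flatten the strict transform of `X` by `ψ₁ : S₁ → S`
(`DeJong1996.flattening_of_stacks081R`), then the strict transform of `T` along `ψ₁` (projective
over `k`, flat over `ψ₁⁻¹U`) by `ψ₂ : S₂ → S₁`, then normalise (`ν : S₃ → S₂`, a finite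
modification, `isModification_normalizationι`); along `ψ = ν ≫ ψ₂ ≫ ψ₁` the strict transforms of
`X` and `T` are flat (tower property) and `S₃` is normal and projective; transport Situation 4.18
to `S₃` with `X₃ ↪ X ×_S S₃` the strict transform (`𝒞 ×_S S₃` integral by Liu 2002, 4.3.8) and
apply 4.19–4.21 (`ThreePointSituation.exists_extension'`); `β' = β̄ ≫ (X₃ ↪ X ×_S S₃)`.

## Sources

* A. J. de Jong, *Smoothness, semi-stability and alterations*, Publ. Math. IHÉS 83 (1996) 51–93:
  2.18–2.19 (pp. 60–61), 4.15 (p. 71), 4.18 (pp. 72–73).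
* The Stacks Project, Tag 03HV (generizations lift along flat morphisms), Tag 01R8.
-/

noncomputable section

open CategoryTheory CategoryTheory.Limits AlgebraicGeometry TopologicalSpace Topology

namespace Literature.AlgebraicGeometry.Resolution

universe u

/-! ## 4.18: the strict transform of 2.18 is all of `X ×_S S'` under b) -/

section StrictTransformSurjective

variable {X S S' : Scheme.{u}} (f : X ⟶ S) (ψ : S' ⟶ S)

/-- **The generic points of the irreducible components of `X ×_S S'` lie over the generic point
of `S'`** as soon as the smooth locus of `f` is dense in every fibre of `f` (de Jong 1996, 4.18
b)): such a generic point `w`, over `s' ∈ S'`, is a generic point of a component of the fibre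
`(X ×_S S')_{s'}`, in which the preimage of `sm(X/S)` is a dense open (the preimage of a dense
open under the flat comparison map to `X_{ψ s'}`), so `w ∈ pr_X⁻¹(sm(X/S))`, over which
`pr_{S'}` is smooth, hence flat, hence generizing: the generization `η' ⤳ s'` lifts to a
generization of `w`, which is `w` itself. [cite: DeJong1996, 4.18, p. 72] -/
theorem pullback_snd_apply_eq_genericPoint_of_mem_genericPoints [IsIntegral S']
    [LocallyOfFinitePresentation f] [∀ y : S, NoetherianSpace ↥(f.fiber y)]
    [∀ y' : S', NoetherianSpace ↥((pullback.snd f ψ).fiber y')]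
    (hb : ∀ y : S, Dense ((f.fiberι y) ⁻¹' (f.smoothLocus : Set X)))
    {w : ↥(pullback f ψ)} (hw : w ∈ genericPoints ↥(pullback f ψ)) :
    pullback.snd f ψ w = genericPoint S' := by
  set O : (pullback f ψ).Opens := pullback.fst f ψ ⁻¹ᵁ f.smoothLocus with hO
  set y' : S' := pullback.snd f ψ w with hy'
  -- the trace of `O` on the fibre of `pr_{S'}` over `y'` is dense
  have h1 : Dense (((pullback.snd f ψ).fiberι y') ⁻¹' (O : Set ↥(pullback f ψ))) := by
    obtain ⟨π, hflat, -, -, hπ⟩ := exists_fiber_snd_flat_surjective f ψ y'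
    haveI := hflat
    have hfun : ∀ z, pullback.fst f ψ (((pullback.snd f ψ).fiberι y') z) =
        f.fiberι (ψ y') (π z) := fun z => by
      rw [← Scheme.Hom.comp_apply, ← Scheme.Hom.comp_apply, hπ]
    have : ((pullback.snd f ψ).fiberι y') ⁻¹' (O : Set ↥(pullback f ψ)) =
        π ⁻¹' ((f.fiberι (ψ y')) ⁻¹' (f.smoothLocus : Set X)) := by
      ext z
      simp only [Set.mem_preimage, hO, Scheme.Hom.coe_preimage, SetLike.mem_coe, hfun]
    rw [this]
    exact dense_preimage_of_flat π
      ((f.fiberι (ψ y')).continuous.isOpen_preimage _ f.smoothLocus.2) (hb (ψ y'))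
  -- `w`, as a point of that fibre, is a generic point of one of its components
  have hwmax := mem_genericPoints_iff_forall_specializes.mp hw
  have hwt : (pullback.snd f ψ).asFiber w ∈ genericPoints ↥((pullback.snd f ψ).fiber y') := by
    rw [mem_genericPoints_iff_forall_specializes]
    intro z hz
    have h2 : (pullback.snd f ψ).fiberι y' z ⤳ w := by
      have := hz.map ((pullback.snd f ψ).fiberι y').continuous
      rwa [Scheme.Hom.fiberι_asFiber] at this
    apply ((pullback.snd f ψ).fiberι y').isEmbedding.injective
    rw [Scheme.Hom.fiberι_asFiber]
    exact hwmax _ h2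
  -- hence `w ∈ O`
  have hwO : w ∈ O := by
    have := genericPoints_subset_of_isOpen_of_dense
      (((pullback.snd f ψ).fiberι y').continuous.isOpen_preimage _ O.2) h1 hwt
    rwa [Set.mem_preimage, Scheme.Hom.fiberι_asFiber] at this
  -- `pr_{S'}` is smooth, hence flat and generizing, on `O`
  haveI : Smooth (O.ι ≫ pullback.snd f ψ) :=
    DeJong1996.StrictTransform.smooth_ι_preimage_smoothLocus_comp_snd f ψ
  have hgen : GeneralizingMap (O.ι ≫ pullback.snd f ψ) := Flat.generalizingMap _
  obtain ⟨v, hv, hv'⟩ := hgen (show genericPoint S' ⤳ (O.ι ≫ pullback.snd f ψ) ⟨w, hwO⟩ from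
    genericPoint_specializes _)
  have h3 : O.ι v ⤳ w := hv.map O.ι.continuous
  have h4 : O.ι v = w := hwmax _ h3
  rw [hy', ← h4, ← Scheme.Hom.comp_apply]
  exact hv'

/-- **De Jong 1996, 4.18: "We remark that `X'` is the strict transform of `X`, see 2.18"** — the
strict transform `X' ↪ X ×_S S'` (2.18, the scheme-theoretic closure of the generic fibre) is
all of `X ×_S S'` set-theoretically, i.e. `X ×_S S'` has no irreducible component over a proper
closed subset of `S'`, when the smooth locus of `f` is dense in all fibres (4.18 b)). So the
reduction `(X ×_S S')_red` of 4.15 and the strict transform of 2.18 have the same support, and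
the 4.15 transport of a)–c), e) applies to the (flat, after 2.19) strict transform.
[cite: DeJong1996, 4.18, p. 72] -/
theorem surjective_strictTransformι [IsIntegral S'] [LocallyOfFinitePresentation f]
    [∀ y : S, NoetherianSpace ↥(f.fiber y)]
    [∀ y' : S', NoetherianSpace ↥((pullback.snd f ψ).fiber y')]
    (hb : ∀ y : S, Dense ((f.fiberι y) ⁻¹' (f.smoothLocus : Set X))) :
    Surjective (strictTransformι f ψ) := by
  refine ⟨fun z => ?_⟩
  -- the generic point `w` of the component of `z` lies over `η'`, hence in the (closed) range
  have hsub : genericPoints ↥(pullback f ψ) ⊆ Set.range (strictTransformι f ψ) := by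
    intro w hw
    rw [range_strictTransformι]
    exact subset_closure (pullback_snd_apply_eq_genericPoint_of_mem_genericPoints f ψ hb hw)
  have hcl : IsClosed (Set.range (strictTransformι f ψ)) :=
    (strictTransformι f ψ).isClosedEmbedding.isClosed_range
  let w := genericPoints.ofComponent ⟨_, irreducibleComponent_mem_irreducibleComponents z⟩
  have hwz : (w : ↥(pullback f ψ)) ⤳ z :=
    (genericPoints.isGenericPoint_ofComponent
      ⟨_, irreducibleComponent_mem_irreducibleComponents z⟩).specializes mem_irreducibleComponent
  exact hcl.stableUnderSpecialization hwz (hsub w.2)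

end StrictTransformSurjective

/-- A morphism which is an isomorphism over the open `⊤` is an isomorphism. [folklore] -/
theorem isIso_of_isIso_morphismRestrict_top {X Y : Scheme.{u}} (f : X ⟶ Y) [IsIso (f ∣_ ⊤)] :
    IsIso f :=
  (MorphismProperty.isomorphisms.iff f).mp
    (IsZariskiLocalAtTarget.of_iSup_eq_top (P := MorphismProperty.isomorphisms Scheme.{u})
      (fun _ : Unit => (⊤ : Y.Opens)) (by simp) fun _ => (MorphismProperty.isomorphisms.iff _).mpr ‹_›)

/-! ## 4.18, "stable under further modifications": strict transforms along a tower -/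

section Tower

variable {X S S₁ S₂ : Scheme.{u}} (f : X ⟶ S) (ψ₁ : S₁ ⟶ S) (χ : S₂ ⟶ S₁) [IsIntegral S₁]

/-- `X₁ ×_{S₁} S₂ → (X ×_S S₁) ×_{S₁} S₂`: the base change along `S₂ → S₁` of the strict transform
`X₁ ↪ X ×_S S₁` of `f` along `ψ₁`. [folklore] -/
def strictTransformPullbackMap :
    pullback (strictTransformMap f ψ₁) χ ⟶ pullback (pullback.snd f ψ₁) χ :=
  pullback.map (strictTransformMap f ψ₁) χ (pullback.snd f ψ₁) χ (strictTransformι f ψ₁) (𝟙 S₂)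
    (𝟙 S₁) (by rw [Category.comp_id, strictTransformι_snd]) (by simp)

/-- `strictTransformPullbackMap` is over `X₁ ↪ X ×_S S₁`. [folklore] -/
@[reassoc (attr := simp)]
theorem strictTransformPullbackMap_fst :
    strictTransformPullbackMap f ψ₁ χ ≫ pullback.fst (pullback.snd f ψ₁) χ =
      pullback.fst (strictTransformMap f ψ₁) χ ≫ strictTransformι f ψ₁ :=
  pullback.lift_fst _ _ _

/-- `strictTransformPullbackMap` is over `S₂`. [folklore] -/
@[reassoc (attr := simp)]
theorem strictTransformPullbackMap_snd :
    strictTransformPullbackMap f ψ₁ χ ≫ pullback.snd (pullback.snd f ψ₁) χ =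
      pullback.snd (strictTransformMap f ψ₁) χ := by
  delta strictTransformPullbackMap pullback.map
  rw [pullback.lift_snd, Category.comp_id]

/-- `X₁ ×_{S₁} S₂ → (X ×_S S₁) ×_{S₁} S₂` is cartesian over `X₁ ↪ X ×_S S₁`. [folklore] -/
theorem isPullback_strictTransformPullbackMap :
    IsPullback (strictTransformPullbackMap f ψ₁ χ) (pullback.fst (strictTransformMap f ψ₁) χ)
      (pullback.fst (pullback.snd f ψ₁) χ) (strictTransformι f ψ₁) := by
  refine IsPullback.of_right ?_ (strictTransformPullbackMap_fst f ψ₁ χ)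
    (IsPullback.of_hasPullback (pullback.snd f ψ₁) χ).flip
  rw [strictTransformPullbackMap_snd]
  exact (IsPullback.of_hasPullback (strictTransformMap f ψ₁) χ).flip

/-- The base change of the closed immersion `X₁ ↪ X ×_S S₁` is a closed immersion. [folklore] -/
instance isClosedImmersion_strictTransformPullbackMap :
    IsClosedImmersion (strictTransformPullbackMap f ψ₁ χ) :=
  MorphismProperty.of_isPullback (isPullback_strictTransformPullbackMap f ψ₁ χ).flip inferInstance

/-- The comparison morphism `X₁ ×_{S₁} S₂ → X ×_S S₂`: `strictTransformPullbackMap` followed by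
`(X ×_S S₁) ×_{S₁} S₂ ≅ X ×_S S₂`. [folklore] -/
def strictTransformPullbackComparison :
    pullback (strictTransformMap f ψ₁) χ ⟶ pullback f (χ ≫ ψ₁) :=
  strictTransformPullbackMap f ψ₁ χ ≫ (pullbackLeftPullbackSndIso f ψ₁ χ).hom

/-- The comparison morphism is a closed immersion. [folklore] -/
instance isClosedImmersion_strictTransformPullbackComparison :
    IsClosedImmersion (strictTransformPullbackComparison f ψ₁ χ) := by
  delta strictTransformPullbackComparison
  infer_instance

/-- The comparison morphism is over `S₂`. [folklore] -/
@[reassoc (attr := simp)]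
theorem strictTransformPullbackComparison_snd :
    strictTransformPullbackComparison f ψ₁ χ ≫ pullback.snd f (χ ≫ ψ₁) =
      pullback.snd (strictTransformMap f ψ₁) χ := by
  simp [strictTransformPullbackComparison]

/-- The comparison morphism is over `X ×_S S₁`, hence over `X`. [folklore] -/
@[reassoc (attr := simp)]
theorem strictTransformPullbackComparison_fst :
    strictTransformPullbackComparison f ψ₁ χ ≫ pullback.fst f (χ ≫ ψ₁) =
      pullback.fst (strictTransformMap f ψ₁) χ ≫ strictTransformFst f ψ₁ := by
  simp only [strictTransformPullbackComparison, Category.assoc, pullbackLeftPullbackSndIso_hom_fst,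
    strictTransformPullbackMap_fst_assoc]
  rfl

/-- Over the open `ψ₁⁻¹(U)`, `U ⊆ S` an open over which `f` is flat, the strict transform
`X₁ → S₁` is flat: there it is the base change of `f|_U` (2.18, `DeJong1996StrictTransformFlatLocus_holds`).
[cite: DeJong1996, 2.18, p. 60] -/
theorem flat_strictTransformMap_morphismRestrict (U : S.Opens) (hflat : Flat (f ∣_ U)) :
    Flat (strictTransformMap f ψ₁ ∣_ ψ₁ ⁻¹ᵁ U) := by
  haveI h1 := DeJong1996StrictTransformFlatLocus_holds X S S₁ f ψ₁ U hflat
  have h2 : Flat (pullback.snd f ψ₁ ∣_ ψ₁ ⁻¹ᵁ U) :=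
    morphismRestrict_pullback_snd_of_morphismRestrict (P := @Flat) f ψ₁ U hflat
  have h3 : Flat (strictTransformι f ψ₁ ∣_ (pullback.snd f ψ₁) ⁻¹ᵁ (ψ₁ ⁻¹ᵁ U)) := inferInstance
  rw [← strictTransformι_snd, morphismRestrict_comp]
  exact MorphismProperty.comp_mem @Flat _ _ h3 h2

/-- The comparison morphism `X₁ ×_{S₁} S₂ → X ×_S S₂` is an isomorphism over `(χ ≫ ψ₁)⁻¹(U)` for
`U ⊆ S` an open over which `f` is flat (base change of "`X₁ ↪ X ×_S S₁` is an isomorphism over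
`ψ₁⁻¹(U)`", 2.18). [cite: DeJong1996, 2.18, p. 60] -/
theorem isIso_strictTransformPullbackComparison_morphismRestrict (U : S.Opens)
    (hflat : Flat (f ∣_ U)) :
    IsIso (strictTransformPullbackComparison f ψ₁ χ ∣_
      (pullback.snd f (χ ≫ ψ₁)) ⁻¹ᵁ ((χ ≫ ψ₁) ⁻¹ᵁ U)) := by
  haveI h1 := DeJong1996StrictTransformFlatLocus_holds X S S₁ f ψ₁ U hflat
  have H := isPullback_strictTransformPullbackMap f ψ₁ χ
  -- the base change of `X₁ ↪ X ×_S S₁` along `(X ×_S S₁) ×_{S₁} S₂ → X ×_S S₁`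
  have h2 : IsIso
      (pullback.fst (pullback.fst (pullback.snd f ψ₁) χ) (strictTransformι f ψ₁) ∣_
        (pullback.fst (pullback.snd f ψ₁) χ) ⁻¹ᵁ ((pullback.snd f ψ₁) ⁻¹ᵁ (ψ₁ ⁻¹ᵁ U))) :=
    (MorphismProperty.isomorphisms.iff _).mp
      (morphismRestrict_pullback_fst_of_morphismRestrict
        (P := MorphismProperty.isomorphisms Scheme.{u}) (pullback.fst (pullback.snd f ψ₁) χ)
        (strictTransformι f ψ₁) _ ((MorphismProperty.isomorphisms.iff _).mpr h1))
  have h3 : IsIso (strictTransformPullbackMap f ψ₁ χ ∣_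
      (pullback.fst (pullback.snd f ψ₁) χ) ⁻¹ᵁ ((pullback.snd f ψ₁) ⁻¹ᵁ (ψ₁ ⁻¹ᵁ U))) := by
    rw [← H.isoPullback_hom_fst, morphismRestrict_comp]
    have h5 : IsIso (H.isoPullback.hom ∣_ (pullback.fst (pullback.fst (pullback.snd f ψ₁) χ)
        (strictTransformι f ψ₁)) ⁻¹ᵁ ((pullback.fst (pullback.snd f ψ₁) χ) ⁻¹ᵁ
          ((pullback.snd f ψ₁) ⁻¹ᵁ (ψ₁ ⁻¹ᵁ U)))) :=
      inferInstance
    exact @IsIso.comp_isIso _ _ _ _ _ _ _ h5 h2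
  have hW : (pullbackLeftPullbackSndIso f ψ₁ χ).hom ⁻¹ᵁ
      ((pullback.snd f (χ ≫ ψ₁)) ⁻¹ᵁ ((χ ≫ ψ₁) ⁻¹ᵁ U)) =
      (pullback.fst (pullback.snd f ψ₁) χ) ⁻¹ᵁ ((pullback.snd f ψ₁) ⁻¹ᵁ (ψ₁ ⁻¹ᵁ U)) := by
    rw [← Scheme.Hom.comp_preimage, pullbackLeftPullbackSndIso_hom_snd, Scheme.Hom.comp_preimage,
      ← Scheme.Hom.comp_preimage (pullback.fst (pullback.snd f ψ₁) χ), pullback.condition,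
      Scheme.Hom.comp_preimage]
  have h4 : IsIso (strictTransformPullbackMap f ψ₁ χ ∣_ (pullbackLeftPullbackSndIso f ψ₁ χ).hom ⁻¹ᵁ
      ((pullback.snd f (χ ≫ ψ₁)) ⁻¹ᵁ ((χ ≫ ψ₁) ⁻¹ᵁ U))) := by
    rw [hW]
    exact h3
  delta strictTransformPullbackComparison
  rw [morphismRestrict_comp]
  exact @IsIso.comp_isIso _ _ _ _ _ _ _ h4 inferInstance

variable [IsIntegral S₂]

/-- **De Jong 1996, 4.18: "This condition [flatness of the strict transform] is also stable under
further modifications of `S`"** — the tower property of strict transforms (2.18): if the strict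
transform of the strict transform `X₁ → S₁` of `f` (along `ψ₁`) along `χ : S₂ → S₁` is flat over
`S₂`, then so is the strict transform of `f` along `χ ≫ ψ₁`; here `U ⊆ S` is an open over which
`f` is flat whose preimage in `S₂` is non-empty. Indeed `X₁₂ ↪ X₁ ×_{S₁} S₂ ↪ X ×_S S₂` is a
closed subscheme, flat over `S₂` and equal to `X ×_S S₂` over `(χ ≫ ψ₁)⁻¹(U)`, hence it is the
strict transform of `f` along `χ ≫ ψ₁` by the uniqueness of 2.18 (`strictTransform_unique`).
[cite: DeJong1996, 2.18 and 4.18, pp. 60, 73] -/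
theorem flat_strictTransformMap_comp (U : S.Opens)
    (hU : (((χ ≫ ψ₁) ⁻¹ᵁ U : S₂.Opens) : Set S₂).Nonempty) (hflat : Flat (f ∣_ U))
    [hZ : Flat (strictTransformMap (strictTransformMap f ψ₁) χ)] :
    Flat (strictTransformMap f (χ ≫ ψ₁)) := by
  set g := strictTransformMap f ψ₁ with hg
  set m := strictTransformPullbackComparison f ψ₁ χ with hm
  set c : strictTransform g χ ⟶ pullback f (χ ≫ ψ₁) := strictTransformι g χ ≫ m with hc
  set V : S₂.Opens := (χ ≫ ψ₁) ⁻¹ᵁ U with hV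
  set W : (pullback f (χ ≫ ψ₁)).Opens := (pullback.snd f (χ ≫ ψ₁)) ⁻¹ᵁ V with hWdef
  have hcsnd : c ≫ pullback.snd f (χ ≫ ψ₁) = strictTransformMap g χ := by
    rw [hc, Category.assoc, hm, strictTransformPullbackComparison_snd]
    rfl
  -- (1) `c` is an isomorphism over `W`
  have hk : IsIso (strictTransformι g χ ∣_ (pullback.snd g χ) ⁻¹ᵁ (χ ⁻¹ᵁ (ψ₁ ⁻¹ᵁ U))) :=
    DeJong1996StrictTransformFlatLocus_holds _ S₁ S₂ g χ (ψ₁ ⁻¹ᵁ U)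
      (flat_strictTransformMap_morphismRestrict f ψ₁ U hflat)
  have hmW : m ⁻¹ᵁ W = (pullback.snd g χ) ⁻¹ᵁ (χ ⁻¹ᵁ (ψ₁ ⁻¹ᵁ U)) := by
    rw [hWdef, ← Scheme.Hom.comp_preimage, hm, strictTransformPullbackComparison_snd, hV,
      Scheme.Hom.comp_preimage]
  have hk' : IsIso (strictTransformι g χ ∣_ m ⁻¹ᵁ W) := by rw [hmW]; exact hk
  have hm' : IsIso (m ∣_ W) :=
    isIso_strictTransformPullbackComparison_morphismRestrict f ψ₁ χ U hflat
  have hcW : IsIso (c ∣_ W) := by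
    rw [hc, morphismRestrict_comp]
    exact @IsIso.comp_isIso _ _ _ _ _ _ _ hk' hm'
  -- (2) `V(ker c) ≅ Z` is flat over `S₂`, and `ker c ≤ ker (W ↪ X ×_S S₂)`
  haveI : Flat (c.ker.subschemeι ≫ pullback.snd f (χ ≫ ψ₁)) := by
    have e1 : c.ker.subschemeι = inv c.toImage ≫ c := by
      rw [IsIso.eq_inv_comp, Scheme.Hom.toImage_imageι]
    rw [e1, Category.assoc, hcsnd]
    infer_instance
  have hle : c.ker ≤ W.ι.ker := by
    have e2 : W.ι = (inv (c ∣_ W) ≫ (c ⁻¹ᵁ W).ι) ≫ c := by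
      rw [Category.assoc, ← morphismRestrict_ι, IsIso.inv_hom_id_assoc]
    rw [e2]
    exact Scheme.Hom.le_ker_comp _ _
  have hker : c.ker = (strictTransformι f (χ ≫ ψ₁)).ker :=
    strictTransform_unique f (χ ≫ ψ₁) c.ker V hU hle
  -- (3) so `Z ≅ X'` over `X ×_S S₂`, and the strict transform of `f` along `χ ≫ ψ₁` is flat
  set l := IsClosedImmersion.lift (strictTransformι f (χ ≫ ψ₁)) c hker.symm.le with hl
  haveI : IsIso l := IsClosedImmersion.isIso_lift (strictTransformι f (χ ≫ ψ₁)) c hker.symm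
  have hlfac : l ≫ strictTransformι f (χ ≫ ψ₁) = c := IsClosedImmersion.lift_fac _ _ _
  have e3 : strictTransformMap f (χ ≫ ψ₁) = inv l ≫ strictTransformMap g χ := by
    rw [← hcsnd, ← hlfac, Category.assoc, IsIso.inv_hom_id_assoc]
    rfl
  rw [e3]
  infer_instance

omit [IsIntegral S₁] in
/-- The flat case of the tower property: the strict transform of a FLAT `g : Y → S₁` along any
`χ : S₂ → S₁` is its base change, hence flat (2.18: the strict transform does nothing over the
flat locus, here everything). [cite: DeJong1996, 2.18, p. 60] -/
theorem flat_strictTransformMap_of_flat {Y : Scheme.{u}} (g : Y ⟶ S₁) [Flat g] :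
    Flat (strictTransformMap g χ) := by
  have h1 : Flat (g ∣_ ⊤) := inferInstance
  have h2 := DeJong1996StrictTransformFlatLocus_holds Y S₁ S₂ g χ ⊤ h1
  have htop : (pullback.snd g χ) ⁻¹ᵁ (χ ⁻¹ᵁ (⊤ : S₁.Opens)) = ⊤ := by
    ext; simp
  rw [htop] at h2
  haveI : IsIso (strictTransformι g χ) := isIso_of_isIso_morphismRestrict_top _
  rw [← strictTransformι_snd]
  infer_instance

end Tower

namespace DeJong1996

/-! ## 4.17/4.18: base change of the model isomorphism `β` along `ψ : S' → S` -/

section ModelBaseChange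

variable {X S S' : Scheme.{u}} (f : X ⟶ S) (ψ : S' ⟶ S) (U : S.Opens)

/-- The open of `X ×_S S'` over `ψ⁻¹(U)` lies over `f⁻¹(U)`. [folklore] -/
theorem preimage_snd_le_preimage_fst :
    (pullback.snd f ψ) ⁻¹ᵁ (ψ ⁻¹ᵁ U) ≤ (pullback.fst f ψ) ⁻¹ᵁ (f ⁻¹ᵁ U) := by
  rw [← Scheme.Hom.comp_preimage, ← pullback.condition, Scheme.Hom.comp_preimage]

/-- **The part of `X ×_S S'` over `ψ⁻¹(U)` is `f⁻¹(U) ×_U ψ⁻¹(U)`**: the square of restrictions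
of the two projections over `U` is cartesian. [folklore] -/
theorem isPullback_resLE_preimage :
    IsPullback ((pullback.fst f ψ).resLE (f ⁻¹ᵁ U) ((pullback.snd f ψ) ⁻¹ᵁ (ψ ⁻¹ᵁ U))
        (preimage_snd_le_preimage_fst f ψ U))
      (pullback.snd f ψ ∣_ ψ ⁻¹ᵁ U) (f ∣_ U) (ψ ∣_ U) := by
  have hUY : (pullback.snd f ψ) ⁻¹ᵁ (ψ ⁻¹ᵁ U) =
      pullback.fst f ψ ⁻¹ᵁ (f ⁻¹ᵁ U) ⊓ pullback.snd f ψ ⁻¹ᵁ (ψ ⁻¹ᵁ U) :=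
    (inf_eq_right.mpr (preimage_snd_le_preimage_fst f ψ U)).symm
  have := Scheme.Hom.isPullback_resLE (IsPullback.of_hasPullback f ψ) (US := U)
    (UT := ψ ⁻¹ᵁ U) (UX := f ⁻¹ᵁ U) le_rfl le_rfl hUY
  rwa [Scheme.Hom.resLE_eq_morphismRestrict, Scheme.Hom.resLE_eq_morphismRestrict,
    Scheme.Hom.resLE_eq_morphismRestrict] at this

variable {f U} {C : Scheme.{u}} {p : C ⟶ S}
  (β : ((p ⁻¹ᵁ U : C.Opens) : Scheme.{u}) ⟶ (f ⁻¹ᵁ U : X.Opens))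

/-- `p|_U = β ≫ f|_U`. [folklore] -/
theorem morphismRestrict_eq_comp_of_comm (hβ : β ≫ (f ⁻¹ᵁ U).ι ≫ f = (p ⁻¹ᵁ U).ι ≫ p) :
    p ∣_ U = β ≫ f ∣_ U := by
  rw [← cancel_mono U.ι, Category.assoc, morphismRestrict_ι, morphismRestrict_ι]
  exact hβ.symm

/-- The part of `𝒞 ×_S S'` over `ψ⁻¹(U)` is also `f⁻¹(U) ×_U ψ⁻¹(U)`, through `β`. [folklore] -/
theorem isPullback_resLE_preimage_comp (hiso : IsIso β)
    (hβ : β ≫ (f ⁻¹ᵁ U).ι ≫ f = (p ⁻¹ᵁ U).ι ≫ p) :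
    IsPullback ((pullback.fst p ψ).resLE (p ⁻¹ᵁ U) ((pullback.snd p ψ) ⁻¹ᵁ (ψ ⁻¹ᵁ U))
        (preimage_snd_le_preimage_fst p ψ U) ≫ β)
      (pullback.snd p ψ ∣_ ψ ⁻¹ᵁ U) (f ∣_ U) (ψ ∣_ U) :=
  (isPullback_resLE_preimage p ψ U).of_iso (Iso.refl _) (asIso β) (Iso.refl _) (Iso.refl _)
    (by simp) (by simp) (by simpa using morphismRestrict_eq_comp_of_comm β hβ) (by simp)

/-- **The base change of the model isomorphism `β : 𝒞_U ⥲ X_U` along `ψ : S' → S`** ("by putting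
`𝒞' = 𝒞 ×_Y Y'`, etc.", 4.17): the isomorphism `(𝒞 ×_S S')|_{ψ⁻¹U} ⥲ (X ×_S S')|_{ψ⁻¹U}` over
`ψ⁻¹(U)` induced by `β` between the two fibre products `𝒞_U ×_U ψ⁻¹(U) ≅ X_U ×_U ψ⁻¹(U)`.
[cite: DeJong1996, 4.17, p. 72] -/
def modelBaseChange (hiso : IsIso β) (hβ : β ≫ (f ⁻¹ᵁ U).ι ≫ f = (p ⁻¹ᵁ U).ι ≫ p) :
    (((pullback.snd p ψ) ⁻¹ᵁ (ψ ⁻¹ᵁ U) : (pullback p ψ).Opens) : Scheme.{u}) ⟶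
      ((pullback.snd f ψ) ⁻¹ᵁ (ψ ⁻¹ᵁ U) : (pullback f ψ).Opens) :=
  (IsPullback.isoIsPullback _ _ (isPullback_resLE_preimage_comp ψ β hiso hβ)
    (isPullback_resLE_preimage f ψ U)).hom

/-- `modelBaseChange` is an isomorphism. [folklore] -/
instance isIso_modelBaseChange (hiso : IsIso β)
    (hβ : β ≫ (f ⁻¹ᵁ U).ι ≫ f = (p ⁻¹ᵁ U).ι ≫ p) : IsIso (modelBaseChange ψ β hiso hβ) := by
  delta modelBaseChange
  infer_instance

/-- `modelBaseChange` is over `ψ⁻¹(U)`. [folklore] -/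
@[reassoc]
theorem modelBaseChange_snd (hiso : IsIso β)
    (hβ : β ≫ (f ⁻¹ᵁ U).ι ≫ f = (p ⁻¹ᵁ U).ι ≫ p) :
    modelBaseChange ψ β hiso hβ ≫ (pullback.snd f ψ ∣_ ψ ⁻¹ᵁ U) = pullback.snd p ψ ∣_ ψ ⁻¹ᵁ U :=
  IsPullback.isoIsPullback_hom_snd _ _ _ _

/-- `modelBaseChange` lies over `β`. [folklore] -/
@[reassoc]
theorem modelBaseChange_fst (hiso : IsIso β)
    (hβ : β ≫ (f ⁻¹ᵁ U).ι ≫ f = (p ⁻¹ᵁ U).ι ≫ p) :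
    modelBaseChange ψ β hiso hβ ≫
        (pullback.fst f ψ).resLE (f ⁻¹ᵁ U) ((pullback.snd f ψ) ⁻¹ᵁ (ψ ⁻¹ᵁ U))
          (preimage_snd_le_preimage_fst f ψ U) =
      (pullback.fst p ψ).resLE (p ⁻¹ᵁ U) ((pullback.snd p ψ) ⁻¹ᵁ (ψ ⁻¹ᵁ U))
        (preimage_snd_le_preimage_fst p ψ U) ≫ β :=
  IsPullback.isoIsPullback_hom_fst _ _ _ _

/-- `modelBaseChange` is over `S'`: followed by the inclusion and `pr_{S'}` it is the inclusion
followed by `pr_{S'}`. [folklore] -/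
@[reassoc]
theorem modelBaseChange_ι_snd (hiso : IsIso β)
    (hβ : β ≫ (f ⁻¹ᵁ U).ι ≫ f = (p ⁻¹ᵁ U).ι ≫ p) :
    modelBaseChange ψ β hiso hβ ≫ ((pullback.snd f ψ) ⁻¹ᵁ (ψ ⁻¹ᵁ U)).ι ≫ pullback.snd f ψ =
      ((pullback.snd p ψ) ⁻¹ᵁ (ψ ⁻¹ᵁ U)).ι ≫ pullback.snd p ψ := by
  rw [← morphismRestrict_ι, modelBaseChange_snd_assoc, morphismRestrict_ι]

/-- `modelBaseChange` followed by the inclusion and `pr_X` is the restriction of `pr_𝒞` followed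
by `β`. [folklore] -/
@[reassoc]
theorem modelBaseChange_ι_fst (hiso : IsIso β)
    (hβ : β ≫ (f ⁻¹ᵁ U).ι ≫ f = (p ⁻¹ᵁ U).ι ≫ p) :
    modelBaseChange ψ β hiso hβ ≫ ((pullback.snd f ψ) ⁻¹ᵁ (ψ ⁻¹ᵁ U)).ι ≫ pullback.fst f ψ =
      (pullback.fst p ψ).resLE (p ⁻¹ᵁ U) ((pullback.snd p ψ) ⁻¹ᵁ (ψ ⁻¹ᵁ U))
        (preimage_snd_le_preimage_fst p ψ U) ≫ β ≫ (f ⁻¹ᵁ U).ι := by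
  rw [← Scheme.Hom.resLE_comp_ι (pullback.fst f ψ) (preimage_snd_le_preimage_fst f ψ U),
    modelBaseChange_fst_assoc]

end ModelBaseChange

/-! ## 4.18: transport of Situation 4.18 a)–c), e), g) along a modification of the base -/

section Transport

variable {X S S' X' C : Scheme.{u}} {f : X ⟶ S} {p : C ⟶ S} {U : S.Opens} (ψ : S' ⟶ S)
  (β : ((p ⁻¹ᵁ U : C.Opens) : Scheme.{u}) ⟶ (f ⁻¹ᵁ U : X.Opens))
  (ι : X' ⟶ pullback f ψ)

/-- **The model isomorphism for the strict transform** ("(vi) g) is preserved by operations as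
in 4.15, by putting `𝒞' = 𝒞 ×_Y Y'`, etc.", 4.17): the base change of `β` along `ψ` followed by
the inverse of `ι : X' → X ×_S S'` over `ψ⁻¹(U)`, where `ι` is an isomorphism.
[cite: DeJong1996, 4.17, p. 72] -/
def transportβ (hiso : IsIso β) (hβ : β ≫ (f ⁻¹ᵁ U).ι ≫ f = (p ⁻¹ᵁ U).ι ≫ p)
    (hι : IsIso (ι ∣_ (pullback.snd f ψ) ⁻¹ᵁ (ψ ⁻¹ᵁ U))) :
    (((pullback.snd p ψ) ⁻¹ᵁ (ψ ⁻¹ᵁ U) : (pullback p ψ).Opens) : Scheme.{u}) ⟶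
      ((ι ≫ pullback.snd f ψ) ⁻¹ᵁ (ψ ⁻¹ᵁ U) : X'.Opens) :=
  modelBaseChange ψ β hiso hβ ≫ inv (ι ∣_ (pullback.snd f ψ) ⁻¹ᵁ (ψ ⁻¹ᵁ U)) (I := hι) ≫
    (X'.isoOfEq (Scheme.Hom.comp_preimage ι (pullback.snd f ψ) (ψ ⁻¹ᵁ U)).symm).hom

/-- `transportβ` is an isomorphism. [folklore] -/
theorem isIso_transportβ (hiso : IsIso β) (hβ : β ≫ (f ⁻¹ᵁ U).ι ≫ f = (p ⁻¹ᵁ U).ι ≫ p)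
    (hι : IsIso (ι ∣_ (pullback.snd f ψ) ⁻¹ᵁ (ψ ⁻¹ᵁ U))) : IsIso (transportβ ψ β ι hiso hβ hι) := by
  haveI := hι
  dsimp only [transportβ]
  infer_instance

/-- `transportβ` followed by the inclusion into `X'` and `ι` is the base change of `β` followed
by the inclusion into `X ×_S S'`. [folklore] -/
@[reassoc]
theorem transportβ_ι_ι (hiso : IsIso β) (hβ : β ≫ (f ⁻¹ᵁ U).ι ≫ f = (p ⁻¹ᵁ U).ι ≫ p)
    (hι : IsIso (ι ∣_ (pullback.snd f ψ) ⁻¹ᵁ (ψ ⁻¹ᵁ U))) :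
    transportβ ψ β ι hiso hβ hι ≫ ((ι ≫ pullback.snd f ψ) ⁻¹ᵁ (ψ ⁻¹ᵁ U)).ι ≫ ι =
      modelBaseChange ψ β hiso hβ ≫ ((pullback.snd f ψ) ⁻¹ᵁ (ψ ⁻¹ᵁ U)).ι := by
  haveI := hι
  dsimp only [transportβ]
  simp only [Category.assoc, Scheme.isoOfEq_hom_ι_assoc]
  rw [← morphismRestrict_ι, IsIso.inv_hom_id_assoc]

/-- `transportβ` is a morphism over `S'` (the field `comm` of Situation 4.18 for the transported
data). [folklore] -/
theorem transportβ_comm (hiso : IsIso β) (hβ : β ≫ (f ⁻¹ᵁ U).ι ≫ f = (p ⁻¹ᵁ U).ι ≫ p)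
    (hι : IsIso (ι ∣_ (pullback.snd f ψ) ⁻¹ᵁ (ψ ⁻¹ᵁ U))) :
    transportβ ψ β ι hiso hβ hι ≫ ((ι ≫ pullback.snd f ψ) ⁻¹ᵁ (ψ ⁻¹ᵁ U)).ι ≫ (ι ≫ pullback.snd f ψ) =
      ((pullback.snd p ψ) ⁻¹ᵁ (ψ ⁻¹ᵁ U)).ι ≫ pullback.snd p ψ := by
  rw [transportβ_ι_ι_assoc, modelBaseChange_ι_snd]

/-- `transportβ` followed by the inclusion, `ι` and `pr_X` is the restriction of `pr_𝒞` followed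
by `β` (used for "`β'` restricts to the base change of `β`"). [folklore] -/
theorem transportβ_ι_ι_fst (hiso : IsIso β) (hβ : β ≫ (f ⁻¹ᵁ U).ι ≫ f = (p ⁻¹ᵁ U).ι ≫ p)
    (hι : IsIso (ι ∣_ (pullback.snd f ψ) ⁻¹ᵁ (ψ ⁻¹ᵁ U))) :
    transportβ ψ β ι hiso hβ hι ≫ ((ι ≫ pullback.snd f ψ) ⁻¹ᵁ (ψ ⁻¹ᵁ U)).ι ≫ ι ≫ pullback.fst f ψ =
      (pullback.fst p ψ).resLE (p ⁻¹ᵁ U) ((pullback.snd p ψ) ⁻¹ᵁ (ψ ⁻¹ᵁ U))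
        (preimage_snd_le_preimage_fst p ψ U) ≫ β ≫ (f ⁻¹ᵁ U).ι := by
  rw [transportβ_ι_ι_assoc, modelBaseChange_ι_fst]

/-- **The sections after transport**: the corestriction `t'` of the pulled-back section `τ'ᵢ` to
the open over `ψ⁻¹(U)` satisfies `t' ≫ β' = σ'ᵢ|_{ψ⁻¹U}` for the transported `β'` and the
sections `σ'ᵢ` of the strict transform, given the same for `β` (the field `fac` of Situation
4.18 for the transported data). [cite: DeJong1996, 4.17, p. 72] -/
theorem transportβ_fac [IsClosedImmersion ι] [Surjective ι] [IsReduced S'] {n : ℕ} {σ : Fin n → (S ⟶ X)} {τ : Fin n → (S ⟶ C)}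
    (hσ : ∀ i, σ i ≫ f = 𝟙 S) (hτ : ∀ i, τ i ≫ p = 𝟙 S) (hiso : IsIso β)
    (hβ : β ≫ (f ⁻¹ᵁ U).ι ≫ f = (p ⁻¹ᵁ U).ι ≫ p)
    (hι : IsIso (ι ∣_ (pullback.snd f ψ) ⁻¹ᵁ (ψ ⁻¹ᵁ U)))
    (hfac : ∀ i, ∃ t : (U : Scheme.{u}) ⟶ (p ⁻¹ᵁ U : C.Opens),
      t ≫ (p ⁻¹ᵁ U).ι = U.ι ≫ τ i ∧ t ≫ β ≫ (f ⁻¹ᵁ U).ι = U.ι ≫ σ i) (i : Fin n) :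
    ∃ t' : ((ψ ⁻¹ᵁ U : S'.Opens) : Scheme.{u}) ⟶ ((pullback.snd p ψ) ⁻¹ᵁ (ψ ⁻¹ᵁ U) : (pullback p ψ).Opens),
      t' ≫ ((pullback.snd p ψ) ⁻¹ᵁ (ψ ⁻¹ᵁ U)).ι =
          (ψ ⁻¹ᵁ U).ι ≫ PreSemiStablePair.pullbackSection hτ ψ i ∧
        t' ≫ transportβ ψ β ι hiso hβ hι ≫ ((ι ≫ pullback.snd f ψ) ⁻¹ᵁ (ψ ⁻¹ᵁ U)).ι =
          (ψ ⁻¹ᵁ U).ι ≫ StrictTransform.sect ι hσ i := by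
  obtain ⟨t, ht, htβ⟩ := hfac i
  -- the corestriction of `τ'ᵢ|_{ψ⁻¹U}` to the open over `ψ⁻¹(U)`
  have hrange : Set.range ((ψ ⁻¹ᵁ U).ι ≫ PreSemiStablePair.pullbackSection hτ ψ i) ⊆
      Set.range ((pullback.snd p ψ) ⁻¹ᵁ (ψ ⁻¹ᵁ U)).ι := by
    rintro _ ⟨y, rfl⟩
    rw [Scheme.Opens.range_ι]
    show pullback.snd p ψ (PreSemiStablePair.pullbackSection hτ ψ i ((ψ ⁻¹ᵁ U).ι y)) ∈ ψ ⁻¹ᵁ U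
    rw [← Scheme.Hom.comp_apply, PreSemiStablePair.pullbackSection_snd]
    exact y.2
  let t' := IsOpenImmersion.lift ((pullback.snd p ψ) ⁻¹ᵁ (ψ ⁻¹ᵁ U)).ι _ hrange
  have ht' : t' ≫ ((pullback.snd p ψ) ⁻¹ᵁ (ψ ⁻¹ᵁ U)).ι =
      (ψ ⁻¹ᵁ U).ι ≫ PreSemiStablePair.pullbackSection hτ ψ i := IsOpenImmersion.lift_fac _ _ _
  refine ⟨t', ht', ?_⟩
  -- `t'` followed by the restriction of `pr_𝒞` is `ψ|_U ≫ t`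
  have h1 : t' ≫ (pullback.fst p ψ).resLE (p ⁻¹ᵁ U) ((pullback.snd p ψ) ⁻¹ᵁ (ψ ⁻¹ᵁ U))
      (preimage_snd_le_preimage_fst p ψ U) = (ψ ∣_ U) ≫ t := by
    rw [← cancel_mono (p ⁻¹ᵁ U).ι]
    simp only [Category.assoc, Scheme.Hom.resLE_comp_ι]
    rw [reassoc_of% ht', PreSemiStablePair.pullbackSection_fst, ht, ← Category.assoc (ψ ∣_ U),
      morphismRestrict_ι, Category.assoc]
  -- compare after the monomorphism `ι`, on the two projections of `X ×_S S'`
  rw [← cancel_mono ι]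
  simp only [Category.assoc, StrictTransform.sect_ι]
  apply pullback.hom_ext
  · simp only [Category.assoc]
    rw [transportβ_ι_ι_fst, reassoc_of% h1, htβ, PreSemiStablePair.pullbackSection_fst,
      ← Category.assoc (ψ ∣_ U), morphismRestrict_ι, Category.assoc]
  · simp only [Category.assoc]
    rw [transportβ_ι_ι_assoc, modelBaseChange_ι_snd, reassoc_of% ht',
      PreSemiStablePair.pullbackSection_snd, PreSemiStablePair.pullbackSection_snd]

end Transport

namespace ThreePointSituation

variable {X S C S' X' : Scheme.{u}} [IsIntegral S] {f : X ⟶ S} [LocallyOfFinitePresentation f]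
  {n : ℕ} {σ : Fin n → (S ⟶ X)} {p : C ⟶ S} {τ : Fin n → (S ⟶ C)} {U : S.Opens}
  {β : ((p ⁻¹ᵁ U : C.Opens) : Scheme.{u}) ⟶ (f ⁻¹ᵁ U : X.Opens)}

/-- **De Jong 1996, 4.18: "Let `S' → S` be a modification and apply the reasoning of 4.15. This
gives a new set of data `X', σ'ᵢ, 𝒞', τ'ᵢ, β'` over the scheme `S'` satisfying the properties
a)–c), e) and g)."** Transport of Situation 4.18 (`ThreePointSituation`) along `ψ : S' → S`
(dominant and surjective from an integral scheme — e.g. a modification) to a strict transform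
`X'` of `X`, delivered as a surjective closed immersion `ι : X' → X ×_S S'` from a reduced scheme
which is an isomorphism over `ψ⁻¹(U)` (the reduction of 4.15, or the flat strict transform of
2.18/2.19 by `surjective_strictTransformι`): `X'` is integral and `f' = ι ≫ pr_{S'}` has a)–c)
(4.15, `AlterationsStrictTransformProofs`), the sections `σ'ᵢ` (`StrictTransform.sect`) give e)
(`StrictTransform.hasThreeSmoothPoints`, `Z' = φ⁻¹Z = ⋃ σ'ᵢ(S')`), and g) holds with the model
`𝒞' = 𝒞 ×_S S'` (assumed integral, as Liu 2002, 4.3.8 provides), its pulled-back sections and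
`β'` the base change of `β` corrected by `ι` (`transportβ`). [cite: DeJong1996, 4.18, p. 72] -/
theorem transport (h : ThreePointSituation f σ p τ U β) (ψ : S' ⟶ S) [IsIntegral S']
    [Surjective ψ] [IsDominant ψ] (ι : X' ⟶ pullback f ψ) [IsClosedImmersion ι] [Surjective ι]
    [IsReduced X'] [LocallyOfFinitePresentation (ι ≫ pullback.snd f ψ)]
    [IsIntegral (pullback p ψ)] (hι : IsIso (ι ∣_ (pullback.snd f ψ) ⁻¹ᵁ (ψ ⁻¹ᵁ U))) :
    ThreePointSituation (ι ≫ pullback.snd f ψ) (StrictTransform.sect ι h.comp_eq_id)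
      (pullback.snd p ψ) (PreSemiStablePair.pullbackSection h.isPointedSemiStableCurve.comp_eq_id ψ)
      (ψ ⁻¹ᵁ U) (transportβ ψ β ι h.isIso h.comm hι) := by
  haveI := h.isProper
  haveI : GeometricallyConnected f := h.isCurveFibration.geometricallyConnected
  haveI : Surjective f := h.isCurveFibration.surjective
  haveI : Nonempty X' := by
    obtain ⟨s, -⟩ := h.nonempty
    obtain ⟨s', rfl⟩ := ψ.surjective s
    obtain ⟨x, hx⟩ := f.surjective (ψ s')
    obtain ⟨z, -, -⟩ := Scheme.Pullback.exists_preimage_pullback (f := f) (g := ψ) x s' hx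
    obtain ⟨x', -⟩ := ι.surjective z
    exact ⟨x'⟩
  have hZ := StrictTransform.preimage_iUnion_range ι h.comp_eq_id (ψ := ψ)
  exact
    { isIntegral := StrictTransform.isIntegral f ψ ι
        h.isCurveFibration.smooth_fiberToSpecResidueField_genericPoint
        h.isCurveFibration.dense_preimage_smoothLocus
      isProper := inferInstance
      comp_eq_id := StrictTransform.sect_snd ι h.comp_eq_id
      isCurveFibration :=
        { locallyOfFinitePresentation := inferInstance
          surjective := inferInstance
          geometricallyConnected := StrictTransform.geometricallyConnected_comp_snd f ψ ι
          topologicalKrullDim_eq_one :=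
            StrictTransform.topologicalKrullDim_fiber_comp_snd f ψ ι
              h.isCurveFibration.topologicalKrullDim_eq_one
          dense_preimage_smoothLocus :=
            StrictTransform.dense_preimage_smoothLocus_comp_snd f ψ ι
              h.isCurveFibration.dense_preimage_smoothLocus
          smooth_fiberToSpecResidueField_genericPoint :=
            StrictTransform.smooth_fiberToSpecResidueField_genericPoint_comp_snd f ψ ι
              h.isCurveFibration.smooth_fiberToSpecResidueField_genericPoint }
      hasThreeSmoothPoints := hZ ▸ StrictTransform.hasThreeSmoothPoints f ψ ι h.hasThreeSmoothPoints
      isIntegral_model := inferInstance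
      isPointedSemiStableCurve := h.isPointedSemiStableCurve.baseChange ψ
      nonempty := by
        obtain ⟨s, hs⟩ := h.nonempty
        obtain ⟨s', rfl⟩ := ψ.surjective s
        exact ⟨s', hs⟩
      isIso := isIso_transportβ ψ β ι h.isIso h.comm hι
      comm := transportβ_comm ψ β ι h.isIso h.comm hι
      fac := transportβ_fac ψ β ι h.comp_eq_id h.isPointedSemiStableCurve.comp_eq_id h.isIso h.comm
        hι h.fac }

end ThreePointSituation

end DeJong1996


namespace DeJong1996

/-! ## 4.18: "the closed subscheme `T' ⊂ 𝒞' ×_{S'} X'` is the strict transform of `T`" -/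

section GraphOverU

variable {X S C : Scheme.{u}} (f : X ⟶ S) (p : C ⟶ S) (U : S.Opens)
  (β : ((p ⁻¹ᵁ U : C.Opens) : Scheme.{u}) ⟶ (f ⁻¹ᵁ U : X.Opens))
  (hβ : β ≫ (f ⁻¹ᵁ U).ι ≫ f = (p ⁻¹ᵁ U).ι ≫ p)

/-- The corestriction of `𝒞_U → T` to the open `T_U = pr₁⁻¹(𝒞_U)` of `T`. [folklore] -/
def toGraphClosureOpen :
    ((p ⁻¹ᵁ U : C.Opens) : Scheme.{u}) ⟶
      ((graphClosureFst f p U β hβ) ⁻¹ᵁ (p ⁻¹ᵁ U) : (graphClosure f p U β hβ).Opens) :=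
  IsOpenImmersion.lift ((graphClosureFst f p U β hβ) ⁻¹ᵁ (p ⁻¹ᵁ U)).ι (toGraphClosure f p U β hβ)
    (by
      rw [Scheme.Opens.range_ι]
      rintro _ ⟨c, rfl⟩
      show graphClosureFst f p U β hβ (toGraphClosure f p U β hβ c) ∈ p ⁻¹ᵁ U
      rw [← Scheme.Hom.comp_apply, toGraphClosure_fst]
      exact c.2)

/-- `toGraphClosureOpen` followed by the inclusion is `𝒞_U → T`. [folklore] -/
@[reassoc (attr := simp)]
theorem toGraphClosureOpen_ι :
    toGraphClosureOpen f p U β hβ ≫ ((graphClosureFst f p U β hβ) ⁻¹ᵁ (p ⁻¹ᵁ U)).ι =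
      toGraphClosure f p U β hβ :=
  IsOpenImmersion.lift_fac _ _ _

/-- `toGraphClosureOpen` is a section of `pr₁|_{𝒞_U} : T_U → 𝒞_U`. [folklore] -/
@[reassoc (attr := simp)]
theorem toGraphClosureOpen_morphismRestrict :
    toGraphClosureOpen f p U β hβ ≫ (graphClosureFst f p U β hβ ∣_ p ⁻¹ᵁ U) = 𝟙 _ := by
  rw [← cancel_mono (p ⁻¹ᵁ U).ι, Category.assoc, morphismRestrict_ι, toGraphClosureOpen_ι_assoc,
    toGraphClosure_fst, Category.id_comp]

/-- Unfolding `T → S`. [folklore] -/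
theorem graphClosureMap_def : graphClosureMap f p U β hβ = graphClosureFst f p U β hβ ≫ p := rfl

/-- Unfolding `pr₁`. [folklore] -/
theorem graphClosureFst_def :
    graphClosureFst f p U β hβ = graphClosureι f p U β hβ ≫ pullback.fst p f := rfl

/-- Unfolding `pr₂`. [folklore] -/
theorem graphClosureSnd_def :
    graphClosureSnd f p U β hβ = graphClosureι f p U β hβ ≫ pullback.snd p f := rfl

variable [IsSeparated f] [QuasiCompact (graphMorphism f p U β hβ)]
  [IsReduced ((p ⁻¹ᵁ U : C.Opens) : Scheme.{u})]

/-- `toGraphClosureOpen` is the inverse of the isomorphism `pr₁|_{𝒞_U} : T_U → 𝒞_U`. [folklore] -/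
theorem toGraphClosureOpen_eq_inv :
    toGraphClosureOpen f p U β hβ =
      inv (graphClosureFst f p U β hβ ∣_ p ⁻¹ᵁ U)
        (I := (isIso_graphClosureFst_morphismRestrict f p U β hβ).1) := by
  haveI := (isIso_graphClosureFst_morphismRestrict f p U β hβ).1
  exact IsIso.eq_inv_of_inv_hom_id (toGraphClosureOpen_morphismRestrict f p U β hβ)

/-- **On `T` over `U`, `pr₂ = β ∘ pr₁`**: the inclusion of `T_U = pr₁⁻¹(𝒞_U)` followed by
`pr₂ : T → X` is `pr₁|_{𝒞_U}` followed by `β` (`T_U ≅ 𝒞_U` through `pr₁`, with inverse the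
graph). [cite: DeJong1996, 4.18–4.19, pp. 72–73] -/
theorem ι_graphClosureSnd_eq :
    ((graphClosureFst f p U β hβ) ⁻¹ᵁ (p ⁻¹ᵁ U)).ι ≫ graphClosureSnd f p U β hβ =
      (graphClosureFst f p U β hβ ∣_ p ⁻¹ᵁ U) ≫ β ≫ (f ⁻¹ᵁ U).ι := by
  haveI := (isIso_graphClosureFst_morphismRestrict f p U β hβ).1
  have h1 : (graphClosureFst f p U β hβ ∣_ p ⁻¹ᵁ U) ≫ toGraphClosureOpen f p U β hβ = 𝟙 _ := by
    rw [toGraphClosureOpen_eq_inv, IsIso.hom_inv_id]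
  rw [← Category.id_comp (((graphClosureFst f p U β hβ) ⁻¹ᵁ (p ⁻¹ᵁ U)).ι), ← h1, Category.assoc,
    Category.assoc, toGraphClosureOpen_ι_assoc, toGraphClosure_snd]

omit [IsSeparated f] [QuasiCompact (graphMorphism f p U β hβ)]
  [IsReduced ((p ⁻¹ᵁ U : C.Opens) : Scheme.{u})] in
/-- `(T → S)⁻¹(U) = pr₁⁻¹(𝒞_U)`. [folklore] -/
theorem graphClosureMap_preimage :
    (graphClosureMap f p U β hβ) ⁻¹ᵁ U = (graphClosureFst f p U β hβ) ⁻¹ᵁ (p ⁻¹ᵁ U) :=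
  Scheme.Hom.comp_preimage _ _ _

/-- The graph isomorphism `𝒞_U ⥲ T|_U` onto the open of `T` over `U` (as an open of `T → S`):
`toGraphClosureOpen` transported along `(T → S)⁻¹(U) = pr₁⁻¹(𝒞_U)`. [folklore] -/
def graphIsoOverU :
    ((p ⁻¹ᵁ U : C.Opens) : Scheme.{u}) ⟶
      ((graphClosureMap f p U β hβ) ⁻¹ᵁ U : (graphClosure f p U β hβ).Opens) :=
  toGraphClosureOpen f p U β hβ ≫
    ((graphClosure f p U β hβ).isoOfEq (graphClosureMap_preimage f p U β hβ).symm).hom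

/-- `graphIsoOverU` is an isomorphism. [folklore] -/
theorem isIso_graphIsoOverU : IsIso (graphIsoOverU f p U β hβ) := by
  haveI := (isIso_graphClosureFst_morphismRestrict f p U β hβ).1
  have : IsIso (toGraphClosureOpen f p U β hβ) := by
    rw [toGraphClosureOpen_eq_inv]; infer_instance
  delta graphIsoOverU
  infer_instance

omit [IsSeparated f] [QuasiCompact (graphMorphism f p U β hβ)]
  [IsReduced ((p ⁻¹ᵁ U : C.Opens) : Scheme.{u})] in
/-- `graphIsoOverU` is a morphism over `S`: followed by the inclusion and `T → S` it is the
inclusion followed by `p`. [folklore] -/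
theorem graphIsoOverU_comm :
    graphIsoOverU f p U β hβ ≫ ((graphClosureMap f p U β hβ) ⁻¹ᵁ U).ι ≫ graphClosureMap f p U β hβ =
      (p ⁻¹ᵁ U).ι ≫ p := by
  rw [graphIsoOverU, Category.assoc, Scheme.isoOfEq_hom_ι_assoc, toGraphClosureOpen_ι_assoc,
    graphClosureMap, toGraphClosure_fst_assoc]

omit [IsSeparated f] [QuasiCompact (graphMorphism f p U β hβ)]
  [IsReduced ((p ⁻¹ᵁ U : C.Opens) : Scheme.{u})] in
/-- `graphIsoOverU` followed by the inclusion into `T` is `𝒞_U → T`. [folklore] -/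
@[reassoc]
theorem graphIsoOverU_ι :
    graphIsoOverU f p U β hβ ≫ ((graphClosureMap f p U β hβ) ⁻¹ᵁ U).ι = toGraphClosure f p U β hβ := by
  rw [graphIsoOverU, Category.assoc, Scheme.isoOfEq_hom_ι, toGraphClosureOpen_ι]

end GraphOverU

section GraphStrictTransform

variable {X S C S' X' : Scheme.{u}} [IsIntegral S] {f : X ⟶ S} [LocallyOfFinitePresentation f]
  {n : ℕ} {σ : Fin n → (S ⟶ X)} {p : C ⟶ S} {τ : Fin n → (S ⟶ C)} {U : S.Opens}
  {β : ((p ⁻¹ᵁ U : C.Opens) : Scheme.{u}) ⟶ (f ⁻¹ᵁ U : X.Opens)}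
  (h : ThreePointSituation f σ p τ U β) (ψ : S' ⟶ S) [IsIntegral S'] [IsNoetherian S]

namespace ThreePointSituation

omit [IsIntegral S'] in
/-- **`(T ×_S S')|_{ψ⁻¹U} ≅ (𝒞 ×_S S')|_{ψ⁻¹U}`**: over `ψ⁻¹(U)` the pulled-back `T` is the
pulled-back `𝒞` (base change of the graph isomorphism `𝒞_U ⥲ T|_U`, `modelBaseChange`). In
particular the former is reduced when `𝒞 ×_S S'` is. [folklore] -/
theorem isReduced_pullback_graphClosureMap_restrict [IsReduced (pullback p ψ)] :
    IsReduced (((pullback.snd (graphClosureMap f p U β h.comm) ψ) ⁻¹ᵁ (ψ ⁻¹ᵁ U) :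
      (pullback (graphClosureMap f p U β h.comm) ψ).Opens) : Scheme.{u}) := by
  haveI := h.isSeparated
  haveI := h.quasiCompact_graphMorphism
  haveI := h.isIntegral_preimage
  haveI := isIso_graphIsoOverU f p U β h.comm
  let e := modelBaseChange ψ (graphIsoOverU f p U β h.comm) (isIso_graphIsoOverU f p U β h.comm)
    (graphIsoOverU_comm f p U β h.comm)
  haveI : IsReduced (((pullback.snd p ψ) ⁻¹ᵁ (ψ ⁻¹ᵁ U) : (pullback p ψ).Opens) : Scheme.{u}) :=
    isReduced_of_isOpenImmersion ((pullback.snd p ψ) ⁻¹ᵁ (ψ ⁻¹ᵁ U)).ι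
  exact isReduced_of_isOpenImmersion (inv e)

/-- The strict transform of `T → S` along `ψ` is reduced (when `𝒞 ×_S S'` is and `ψ⁻¹(U) ≠ ∅`):
it is the scheme-theoretic image of the generic fibre of `T ×_S S' → S'`, which embeds flatly
into the reduced open part over `ψ⁻¹(U)`. [folklore] -/
theorem isReduced_strictTransform_graphClosureMap [IsReduced (pullback p ψ)]
    (hU : genericPoint S' ∈ ψ ⁻¹ᵁ U) :
    IsReduced (strictTransform (graphClosureMap f p U β h.comm) ψ) := by
  set g := graphClosureMap f p U β h.comm
  haveI := h.isReduced_pullback_graphClosureMap_restrict ψ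
  haveI : Flat (S'.fromSpecResidueField (genericPoint S')) :=
    Literature.AlgebraicGeometry.Morphisms.flat_fromSpecResidueField_genericPoint S'
  haveI : Flat ((pullback.snd g ψ).fiberι (genericPoint S')) :=
    MorphismProperty.pullback_fst (P := @Flat) _ _ inferInstance
  have hjW : ∀ z, (pullback.snd g ψ).fiberι (genericPoint S') z ∈
      (pullback.snd g ψ) ⁻¹ᵁ (ψ ⁻¹ᵁ U) := by
    intro z
    show pullback.snd g ψ ((pullback.snd g ψ).fiberι (genericPoint S') z) ∈ ψ ⁻¹ᵁ U
    have : pullback.snd g ψ ((pullback.snd g ψ).fiberι (genericPoint S') z) = genericPoint S' := by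
      have hz := Scheme.Hom.range_fiberι (pullback.snd g ψ) (genericPoint S')
      exact (hz ▸ Set.mem_range_self z : _ ∈ (pullback.snd g ψ) ⁻¹' {genericPoint S'})
    rw [this]
    exact hU
  haveI : IsReduced ((pullback.snd g ψ).fiber (genericPoint S')) := by
    refine isReduced_of_flat_of_isPreimmersion ((pullback.snd g ψ).fiberι (genericPoint S'))
      fun z => ?_
    let w : (((pullback.snd g ψ) ⁻¹ᵁ (ψ ⁻¹ᵁ U) : (pullback g ψ).Opens) : Scheme.{u}) := ⟨_, hjW z⟩
    exact isReduced_of_injective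
      (((pullback.snd g ψ) ⁻¹ᵁ (ψ ⁻¹ᵁ U)).stalkIso w).commRingCatIsoToRingEquiv.symm
      (((pullback.snd g ψ) ⁻¹ᵁ (ψ ⁻¹ᵁ U)).stalkIso w).commRingCatIsoToRingEquiv.symm.injective
  haveI := Literature.AlgebraicGeometry.Motives.quasiCompact_fiberι (pullback.snd g ψ) (genericPoint S')
  exact ChowLemmaProof.isReduced_image _

variable (ι : X' ⟶ pullback f ψ) [IsClosedImmersion ι] [Surjective ι] [IsIntegral (pullback p ψ)]

/-- The morphism `T^{st} → 𝒞' ×_{S'} X'` from the strict transform of `T` to the ambient of `T'`: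
to `𝒞' = 𝒞 ×_S S'` by `(pr₁, pr_{S'})`, to `X'` by lifting `(pr₂, pr_{S'}) : T^{st} → X ×_S S'`
through the surjective closed immersion `ι` (the source being reduced). [folklore] -/
def strictTransformToAmbient (hU : genericPoint S' ∈ ψ ⁻¹ᵁ U) :
    strictTransform (graphClosureMap f p U β h.comm) ψ ⟶
      pullback (pullback.snd p ψ) (ι ≫ pullback.snd f ψ) :=
  haveI := h.isReduced_strictTransform_graphClosureMap ψ hU
  pullback.lift
    (pullback.lift
      (strictTransformFst (graphClosureMap f p U β h.comm) ψ ≫ graphClosureFst f p U β h.comm)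
      (strictTransformMap (graphClosureMap f p U β h.comm) ψ)
      (by rw [Category.assoc, ← graphClosureMap, ← strictTransformMap_comp]))
    (IsClosedImmersion.liftOfRange ι
      (pullback.lift
        (strictTransformFst (graphClosureMap f p U β h.comm) ψ ≫ graphClosureSnd f p U β h.comm)
        (strictTransformMap (graphClosureMap f p U β h.comm) ψ)
        (by rw [Category.assoc, ← graphClosureMap_eq, ← strictTransformMap_comp]))
      (by rw [Set.range_eq_univ.mpr ι.surjective]; exact Set.subset_univ _))
    (by simp only [pullback.lift_snd, IsClosedImmersion.liftOfRange_fac_assoc])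

/-- `strictTransformToAmbient` composed to `𝒞 ×_S S'`. [folklore] -/
@[reassoc]
theorem strictTransformToAmbient_fst (hU : genericPoint S' ∈ ψ ⁻¹ᵁ U) :
    h.strictTransformToAmbient ψ ι hU ≫ pullback.fst _ _ =
      pullback.lift
        (strictTransformFst (graphClosureMap f p U β h.comm) ψ ≫ graphClosureFst f p U β h.comm)
        (strictTransformMap (graphClosureMap f p U β h.comm) ψ)
        (by rw [Category.assoc, ← graphClosureMap, ← strictTransformMap_comp]) :=
  pullback.lift_fst _ _ _

/-- `strictTransformToAmbient` composed to `X'`. [folklore] -/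
@[reassoc]
theorem strictTransformToAmbient_snd (hU : genericPoint S' ∈ ψ ⁻¹ᵁ U) :
    h.strictTransformToAmbient ψ ι hU ≫ pullback.snd _ _ =
      haveI := h.isReduced_strictTransform_graphClosureMap ψ hU
      IsClosedImmersion.liftOfRange ι
        (pullback.lift
          (strictTransformFst (graphClosureMap f p U β h.comm) ψ ≫ graphClosureSnd f p U β h.comm)
          (strictTransformMap (graphClosureMap f p U β h.comm) ψ)
          (by rw [Category.assoc, ← graphClosureMap_eq, ← strictTransformMap_comp]))
        (by rw [Set.range_eq_univ.mpr ι.surjective]; exact Set.subset_univ _) :=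
  pullback.lift_snd _ _ _

/-- `strictTransformToAmbient` composed to `X'` and `ι`. [folklore] -/
@[reassoc]
theorem strictTransformToAmbient_snd_ι (hU : genericPoint S' ∈ ψ ⁻¹ᵁ U) :
    h.strictTransformToAmbient ψ ι hU ≫ pullback.snd _ _ ≫ ι =
      pullback.lift
        (strictTransformFst (graphClosureMap f p U β h.comm) ψ ≫ graphClosureSnd f p U β h.comm)
        (strictTransformMap (graphClosureMap f p U β h.comm) ψ)
        (by rw [Category.assoc, ← graphClosureMap_eq, ← strictTransformMap_comp]) := by
  haveI := h.isReduced_strictTransform_graphClosureMap ψ hU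
  rw [strictTransformToAmbient_snd_assoc, IsClosedImmersion.liftOfRange_fac]

/-- `T^{st} → 𝒞' ×_{S'} X' → 𝒞' → 𝒞` is `T^{st} → T → 𝒞`. [folklore] -/
@[reassoc]
theorem strictTransformToAmbient_fst_fst (hU : genericPoint S' ∈ ψ ⁻¹ᵁ U) :
    h.strictTransformToAmbient ψ ι hU ≫ pullback.fst _ _ ≫ pullback.fst p ψ =
      strictTransformFst (graphClosureMap f p U β h.comm) ψ ≫ graphClosureFst f p U β h.comm := by
  rw [strictTransformToAmbient_fst_assoc, pullback.lift_fst]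

/-- `T^{st} → 𝒞' ×_{S'} X' → 𝒞' → S'` is `T^{st} → S'`. [folklore] -/
@[reassoc]
theorem strictTransformToAmbient_fst_snd (hU : genericPoint S' ∈ ψ ⁻¹ᵁ U) :
    h.strictTransformToAmbient ψ ι hU ≫ pullback.fst _ _ ≫ pullback.snd p ψ =
      strictTransformMap (graphClosureMap f p U β h.comm) ψ := by
  rw [strictTransformToAmbient_fst_assoc, pullback.lift_snd]

/-- `T^{st} → 𝒞' ×_{S'} X' → X' → X ×_S S' → X` is `T^{st} → T → X`. [folklore] -/
@[reassoc]
theorem strictTransformToAmbient_snd_ι_fst (hU : genericPoint S' ∈ ψ ⁻¹ᵁ U) :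
    h.strictTransformToAmbient ψ ι hU ≫ pullback.snd _ _ ≫ ι ≫ pullback.fst f ψ =
      strictTransformFst (graphClosureMap f p U β h.comm) ψ ≫ graphClosureSnd f p U β h.comm := by
  rw [strictTransformToAmbient_snd_ι_assoc, pullback.lift_fst]

/-- `T^{st} → 𝒞' ×_{S'} X' → X' → X ×_S S' → S'` is `T^{st} → S'`. [folklore] -/
@[reassoc]
theorem strictTransformToAmbient_snd_ι_snd (hU : genericPoint S' ∈ ψ ⁻¹ᵁ U) :
    h.strictTransformToAmbient ψ ι hU ≫ pullback.snd _ _ ≫ ι ≫ pullback.snd f ψ =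
      strictTransformMap (graphClosureMap f p U β h.comm) ψ := by
  rw [strictTransformToAmbient_snd_ι_assoc, pullback.lift_snd]

variable [IsReduced X'] [LocallyOfFinitePresentation (ι ≫ pullback.snd f ψ)] [IsNoetherian S']
  [Surjective ψ] [IsDominant ψ]

/-- **The strict transform of `T` maps into `T'`**: the range of `T^{st} → 𝒞' ×_{S'} X'` lies in
(the support of) the closure `T'` of the graph of the transported `β'`. Over `ψ⁻¹(U)` the
morphism factors through the graph of `β'` (there `T` is the graph of `β`, `ι_graphClosureSnd_eq`),
and the part of `T^{st}` over `ψ⁻¹(U)` is dense (it contains the generic fibre, whose closure is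
`T^{st}`). [cite: DeJong1996, 4.18, p. 72] -/
theorem range_strictTransformToAmbient_subset
    (hι : IsIso (ι ∣_ (pullback.snd f ψ) ⁻¹ᵁ (ψ ⁻¹ᵁ U))) (hU : genericPoint S' ∈ ψ ⁻¹ᵁ U) :
    Set.range (h.strictTransformToAmbient ψ ι hU) ⊆
      Set.range (graphClosureι (ι ≫ pullback.snd f ψ) (pullback.snd p ψ) (ψ ⁻¹ᵁ U)
        (transportβ ψ β ι h.isIso h.comm hι) (h.transport ψ ι hι).comm) := by
  have h' := h.transport ψ ι hι
  haveI := h'.quasiCompact_graphMorphism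
  haveI := h.isReduced_strictTransform_graphClosureMap ψ hU
  haveI := h.isSeparated
  haveI := h.quasiCompact_graphMorphism
  haveI := h.isIntegral_preimage
  set g := graphClosureMap f p U β h.comm with hg
  set k := strictTransformι g ψ with hk
  set a := h.strictTransformToAmbient ψ ι hU with ha
  set V : (strictTransform g ψ).Opens := k ⁻¹ᵁ ((pullback.snd g ψ) ⁻¹ᵁ (ψ ⁻¹ᵁ U)) with hV
  -- (1) `V`, the part of `T^{st}` over `ψ⁻¹(U)`, is dense in `T^{st}`
  have hVd : closure (V : Set (strictTransform g ψ)) = Set.univ := by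
    apply Set.eq_univ_of_univ_subset
    have hG : k ⁻¹' ((pullback.snd g ψ) ⁻¹' {genericPoint S'}) ⊆ (V : Set (strictTransform g ψ)) := by
      intro t ht
      show pullback.snd g ψ (k t) ∈ ψ ⁻¹ᵁ U
      rw [show pullback.snd g ψ (k t) = genericPoint S' from ht]
      exact hU
    refine le_trans ?_ (closure_mono hG)
    have hrk : Set.range k = closure ((pullback.snd g ψ) ⁻¹' {genericPoint S'}) := by
      rw [hk]; exact range_strictTransformι g ψ
    rw [k.isClosedEmbedding.isInducing.closure_eq_preimage_closure_image,
      Set.image_preimage_eq_inter_range, hrk, Set.inter_eq_left.mpr subset_closure, ← hrk]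
    intro t _
    exact ⟨t, rfl⟩
  -- (2) on `V` the morphism factors through the graph of `β'`
  have hrange : Set.range (V.ι ≫ a ≫ pullback.fst _ _) ⊆
      Set.range ((pullback.snd p ψ) ⁻¹ᵁ (ψ ⁻¹ᵁ U)).ι := by
    rw [Scheme.Opens.range_ι]
    rintro _ ⟨t, rfl⟩
    show pullback.snd p ψ ((V.ι ≫ a ≫ pullback.fst _ _) t) ∈ ψ ⁻¹ᵁ U
    rw [← Scheme.Hom.comp_apply]
    simp only [Category.assoc, ha, strictTransformToAmbient_fst, pullback.lift_snd]
    exact t.2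
  let m : (V : Scheme.{u}) ⟶ ((pullback.snd p ψ) ⁻¹ᵁ (ψ ⁻¹ᵁ U) : (pullback p ψ).Opens) :=
    IsOpenImmersion.lift _ _ hrange
  have hm : m ≫ ((pullback.snd p ψ) ⁻¹ᵁ (ψ ⁻¹ᵁ U)).ι = V.ι ≫ a ≫ pullback.fst _ _ :=
    IsOpenImmersion.lift_fac _ _ _
  -- the restriction of `T ×_S S' → T` over `ψ⁻¹(U)` lands in `T_U`
  have hle : (pullback.snd g ψ) ⁻¹ᵁ (ψ ⁻¹ᵁ U) ≤
      (pullback.fst g ψ) ⁻¹ᵁ ((graphClosureFst f p U β h.comm) ⁻¹ᵁ (p ⁻¹ᵁ U)) := by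
    rw [← graphClosureMap_preimage]
    exact preimage_snd_le_preimage_fst g ψ U
  have hfac : V.ι ≫ a = m ≫ graphMorphism (ι ≫ pullback.snd f ψ) (pullback.snd p ψ) (ψ ⁻¹ᵁ U)
      (transportβ ψ β ι h.isIso h.comm hι) h'.comm := by
    apply pullback.hom_ext
    · rw [Category.assoc, Category.assoc, graphMorphism_fst, hm]
    · rw [← cancel_mono ι]
      simp only [Category.assoc, graphMorphism_snd]
      rw [ha, strictTransformToAmbient_snd_ι]
      apply pullback.hom_ext
      · simp only [Category.assoc, pullback.lift_fst]
        rw [transportβ_ι_ι_fst]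
        -- both sides factor through `pr₁|_{𝒞_U} : T_U → 𝒞_U` and `β`
        have e1 : V.ι ≫ strictTransformFst g ψ =
            (k ∣_ (pullback.snd g ψ) ⁻¹ᵁ (ψ ⁻¹ᵁ U)) ≫
              (pullback.fst g ψ).resLE _ _ hle ≫
                ((graphClosureFst f p U β h.comm) ⁻¹ᵁ (p ⁻¹ᵁ U)).ι := by
          rw [Scheme.Hom.resLE_comp_ι, morphismRestrict_ι_assoc]
          rfl
        have e2 : m ≫ (pullback.fst p ψ).resLE (p ⁻¹ᵁ U) ((pullback.snd p ψ) ⁻¹ᵁ (ψ ⁻¹ᵁ U))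
            (preimage_snd_le_preimage_fst p ψ U) =
            (k ∣_ (pullback.snd g ψ) ⁻¹ᵁ (ψ ⁻¹ᵁ U)) ≫ (pullback.fst g ψ).resLE _ _ hle ≫
              (graphClosureFst f p U β h.comm ∣_ p ⁻¹ᵁ U) := by
          rw [← cancel_mono (p ⁻¹ᵁ U).ι]
          simp only [Category.assoc, Scheme.Hom.resLE_comp_ι, morphismRestrict_ι]
          rw [reassoc_of% hm, ha, strictTransformToAmbient_fst_assoc, pullback.lift_fst,
            ← reassoc_of% e1]
        rw [reassoc_of% e1, ι_graphClosureSnd_eq, reassoc_of% e2]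
      · simp only [Category.assoc, pullback.lift_snd]
        rw [transportβ_ι_ι_assoc, modelBaseChange_ι_snd, reassoc_of% hm, ha,
          strictTransformToAmbient_fst_assoc, pullback.lift_snd]
  -- (3) conclude by continuity
  rw [range_graphClosureι]
  have hcont : Continuous a := a.continuous
  calc Set.range a = a '' closure (V : Set (strictTransform g ψ)) := by
          rw [hVd, Set.image_univ]
    _ ⊆ closure (a '' (V : Set (strictTransform g ψ))) := image_closure_subset_closure_image hcont
    _ ⊆ closure (Set.range (graphMorphism (ι ≫ pullback.snd f ψ) (pullback.snd p ψ) (ψ ⁻¹ᵁ U)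
          (transportβ ψ β ι h.isIso h.comm hι) h'.comm)) := by
          apply closure_mono
          rintro _ ⟨t, ht, rfl⟩
          refine ⟨m ⟨t, ht⟩, ?_⟩
          have := congrArg (fun φ => φ ⟨t, ht⟩) (congrArg (fun φ : (V : Scheme.{u}) ⟶ _ => ⇑φ) hfac)
          simpa [Scheme.Hom.comp_apply] using this.symm

omit [AlgebraicGeometry.IsNoetherian S] [AlgebraicGeometry.IsNoetherian S'] in
/-- Unfolding `T' → S'` for the transported data. [folklore] -/
theorem graphClosureMap_transport_def (hι : IsIso (ι ∣_ (pullback.snd f ψ) ⁻¹ᵁ (ψ ⁻¹ᵁ U))) :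
    graphClosureMap (ι ≫ pullback.snd f ψ) (pullback.snd p ψ) (ψ ⁻¹ᵁ U)
        (transportβ ψ β ι h.isIso h.comm hι) (h.transport ψ ι hι).comm =
      (graphClosureι _ _ _ _ (h.transport ψ ι hι).comm ≫ pullback.fst _ _) ≫ pullback.snd p ψ :=
  rfl

/-- The morphism `T' → 𝒞 ×_S X` from the closure `T'` of the graph of the transported `β'`:
`(pr₁' ≫ pr_𝒞, pr₂' ≫ ι ≫ pr_X)`. [folklore] -/
def graphClosureTransportToAmbient (hι : IsIso (ι ∣_ (pullback.snd f ψ) ⁻¹ᵁ (ψ ⁻¹ᵁ U))) :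
    graphClosure (ι ≫ pullback.snd f ψ) (pullback.snd p ψ) (ψ ⁻¹ᵁ U)
        (transportβ ψ β ι h.isIso h.comm hι) (h.transport ψ ι hι).comm ⟶ pullback p f :=
  pullback.lift
    (graphClosureι _ _ _ _ (h.transport ψ ι hι).comm ≫ pullback.fst _ _ ≫ pullback.fst p ψ)
    (graphClosureι _ _ _ _ (h.transport ψ ι hι).comm ≫ pullback.snd _ _ ≫ ι ≫ pullback.fst f ψ)
    (by
      simp only [Category.assoc, pullback.condition]
      rw [pullback.condition_assoc, Category.assoc])

omit [AlgebraicGeometry.IsNoetherian S] [AlgebraicGeometry.IsNoetherian S'] in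
/-- `T' → 𝒞 ×_S X → 𝒞` is `T' → 𝒞' → 𝒞`. [folklore] -/
@[reassoc]
theorem graphClosureTransportToAmbient_fst (hι : IsIso (ι ∣_ (pullback.snd f ψ) ⁻¹ᵁ (ψ ⁻¹ᵁ U))) :
    h.graphClosureTransportToAmbient ψ ι hι ≫ pullback.fst p f =
      graphClosureι _ _ _ _ (h.transport ψ ι hι).comm ≫ pullback.fst _ _ ≫ pullback.fst p ψ :=
  pullback.lift_fst _ _ _

omit [AlgebraicGeometry.IsNoetherian S] [AlgebraicGeometry.IsNoetherian S'] in
/-- `T' → 𝒞 ×_S X → X` is `T' → X' → X ×_S S' → X`. [folklore] -/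
@[reassoc]
theorem graphClosureTransportToAmbient_snd (hι : IsIso (ι ∣_ (pullback.snd f ψ) ⁻¹ᵁ (ψ ⁻¹ᵁ U))) :
    h.graphClosureTransportToAmbient ψ ι hι ≫ pullback.snd p f =
      graphClosureι _ _ _ _ (h.transport ψ ι hι).comm ≫ pullback.snd _ _ ≫ ι ≫ pullback.fst f ψ :=
  pullback.lift_snd _ _ _

/-- **`T'` maps into `T`**: the range of `T' → 𝒞 ×_S X` lies in (the support of) `T`: on the
graph of `β'` the morphism is the restriction of `pr_𝒞` followed by the graph of `β`
(`transportβ_ι_ι_fst`), and the graph is dense in `T'`. [cite: DeJong1996, 4.18, p. 72] -/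
theorem range_graphClosureTransportToAmbient_subset
    (hι : IsIso (ι ∣_ (pullback.snd f ψ) ⁻¹ᵁ (ψ ⁻¹ᵁ U))) :
    Set.range (h.graphClosureTransportToAmbient ψ ι hι) ⊆
      Set.range (graphClosureι f p U β h.comm) := by
  have h' := h.transport ψ ι hι
  haveI := h'.quasiCompact_graphMorphism
  haveI := h.quasiCompact_graphMorphism
  set bP := h.graphClosureTransportToAmbient ψ ι hι with hbP
  set t' := toGraphClosure (ι ≫ pullback.snd f ψ) (pullback.snd p ψ) (ψ ⁻¹ᵁ U)
    (transportβ ψ β ι h.isIso h.comm hι) h'.comm with ht'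
  -- on the graph of `β'`
  have hfac : t' ≫ bP =
      (pullback.fst p ψ).resLE (p ⁻¹ᵁ U) ((pullback.snd p ψ) ⁻¹ᵁ (ψ ⁻¹ᵁ U))
        (preimage_snd_le_preimage_fst p ψ U) ≫ graphMorphism f p U β h.comm := by
    apply pullback.hom_ext
    · rw [hbP, Category.assoc, graphClosureTransportToAmbient_fst, Category.assoc,
        graphMorphism_fst, Scheme.Hom.resLE_comp_ι, ht', toGraphClosure_ι_assoc, graphMorphism_fst_assoc]
    · rw [hbP, Category.assoc, graphClosureTransportToAmbient_snd, Category.assoc,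
        graphMorphism_snd, ht', toGraphClosure_ι_assoc, graphMorphism_snd_assoc, transportβ_ι_ι_fst]
  -- conclude by continuity and density of the graph
  rw [range_graphClosureι]
  have hd : closure (Set.range t') = Set.univ := t'.denseRange.closure_range
  calc Set.range bP = bP '' closure (Set.range t') := by rw [hd, Set.image_univ]
    _ ⊆ closure (bP '' Set.range t') := image_closure_subset_closure_image bP.continuous
    _ ⊆ closure (Set.range (graphMorphism f p U β h.comm)) := by
          apply closure_mono
          rw [← Set.range_comp]
          rintro _ ⟨c, rfl⟩
          have e := Scheme.Hom.comp_apply t' bP c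
          rw [hfac, Scheme.Hom.comp_apply] at e
          exact ⟨_, e⟩

/-- The morphism `T' → T` (the lift of `graphClosureTransportToAmbient` through `T ↪ 𝒞 ×_S X`,
`T'` being reduced). [folklore] -/
def graphClosureTransportToGraphClosure (hι : IsIso (ι ∣_ (pullback.snd f ψ) ⁻¹ᵁ (ψ ⁻¹ᵁ U))) :
    graphClosure (ι ≫ pullback.snd f ψ) (pullback.snd p ψ) (ψ ⁻¹ᵁ U)
        (transportβ ψ β ι h.isIso h.comm hι) (h.transport ψ ι hι).comm ⟶
      graphClosure f p U β h.comm :=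
  haveI := (h.transport ψ ι hι).quasiCompact_graphMorphism
  haveI := (h.transport ψ ι hι).isIntegral_preimage
  haveI := isReduced_graphClosure _ _ _ _ (h.transport ψ ι hι).comm
  IsClosedImmersion.liftOfRange (graphClosureι f p U β h.comm) (h.graphClosureTransportToAmbient ψ ι hι)
    (h.range_graphClosureTransportToAmbient_subset ψ ι hι)

/-- `T' → T ↪ 𝒞 ×_S X` is `graphClosureTransportToAmbient`. [folklore] -/
@[reassoc (attr := simp)]
theorem graphClosureTransportToGraphClosure_ι (hι : IsIso (ι ∣_ (pullback.snd f ψ) ⁻¹ᵁ (ψ ⁻¹ᵁ U))) :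
    h.graphClosureTransportToGraphClosure ψ ι hι ≫ graphClosureι f p U β h.comm =
      h.graphClosureTransportToAmbient ψ ι hι := by
  haveI := (h.transport ψ ι hι).quasiCompact_graphMorphism
  haveI := (h.transport ψ ι hι).isIntegral_preimage
  haveI := isReduced_graphClosure _ _ _ _ (h.transport ψ ι hι).comm
  exact IsClosedImmersion.liftOfRange_fac _ _ _

/-- `T' → T → 𝒞` is `T' → 𝒞' → 𝒞`. [folklore] -/
@[reassoc]
theorem graphClosureTransportToGraphClosure_fst (hι : IsIso (ι ∣_ (pullback.snd f ψ) ⁻¹ᵁ (ψ ⁻¹ᵁ U))) :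
    h.graphClosureTransportToGraphClosure ψ ι hι ≫ graphClosureFst f p U β h.comm =
      graphClosureι _ _ _ _ (h.transport ψ ι hι).comm ≫ pullback.fst _ _ ≫ pullback.fst p ψ := by
  rw [graphClosureFst_def, graphClosureTransportToGraphClosure_ι_assoc, graphClosureTransportToAmbient_fst]

/-- `T' → T → X` is `T' → X' → X ×_S S' → X`. [folklore] -/
@[reassoc]
theorem graphClosureTransportToGraphClosure_snd (hι : IsIso (ι ∣_ (pullback.snd f ψ) ⁻¹ᵁ (ψ ⁻¹ᵁ U))) :
    h.graphClosureTransportToGraphClosure ψ ι hι ≫ graphClosureSnd f p U β h.comm =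
      graphClosureι _ _ _ _ (h.transport ψ ι hι).comm ≫ pullback.snd _ _ ≫ ι ≫ pullback.fst f ψ := by
  rw [graphClosureSnd_def, graphClosureTransportToGraphClosure_ι_assoc, graphClosureTransportToAmbient_snd]

/-- `T' → T → S` is `T' → S' → S`. [folklore] -/
@[reassoc]
theorem graphClosureTransportToGraphClosure_map (hι : IsIso (ι ∣_ (pullback.snd f ψ) ⁻¹ᵁ (ψ ⁻¹ᵁ U))) :
    h.graphClosureTransportToGraphClosure ψ ι hι ≫ graphClosureMap f p U β h.comm =
      graphClosureMap _ _ _ _ (h.transport ψ ι hι).comm ≫ ψ := by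
  rw [graphClosureMap_def, graphClosureTransportToGraphClosure_fst_assoc,
    pullback.condition, graphClosureMap_def, graphClosureFst_def, Category.assoc, Category.assoc]

/-- The morphism `T' → T ×_S S'`: `(T' → T, T' → S')`. [folklore] -/
def graphClosureTransportToPullback (hι : IsIso (ι ∣_ (pullback.snd f ψ) ⁻¹ᵁ (ψ ⁻¹ᵁ U))) :
    graphClosure (ι ≫ pullback.snd f ψ) (pullback.snd p ψ) (ψ ⁻¹ᵁ U)
        (transportβ ψ β ι h.isIso h.comm hι) (h.transport ψ ι hι).comm ⟶
      pullback (graphClosureMap f p U β h.comm) ψ :=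
  pullback.lift (h.graphClosureTransportToGraphClosure ψ ι hι)
    (graphClosureMap _ _ _ _ (h.transport ψ ι hι).comm) (h.graphClosureTransportToGraphClosure_map ψ ι hι)

/-- `T' → T ×_S S' → T`. [folklore] -/
@[reassoc]
theorem graphClosureTransportToPullback_fst (hι : IsIso (ι ∣_ (pullback.snd f ψ) ⁻¹ᵁ (ψ ⁻¹ᵁ U))) :
    h.graphClosureTransportToPullback ψ ι hι ≫ pullback.fst _ _ =
      h.graphClosureTransportToGraphClosure ψ ι hι :=
  pullback.lift_fst _ _ _

/-- `T' → T ×_S S' → S'`. [folklore] -/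
@[reassoc]
theorem graphClosureTransportToPullback_snd (hι : IsIso (ι ∣_ (pullback.snd f ψ) ⁻¹ᵁ (ψ ⁻¹ᵁ U))) :
    h.graphClosureTransportToPullback ψ ι hι ≫ pullback.snd _ _ =
      graphClosureMap _ _ _ _ (h.transport ψ ι hι).comm :=
  pullback.lift_snd _ _ _

/-- **`T' → T ×_S S'` lands in the strict transform of `T`**: its range lies in the closure of
the generic fibre of `T ×_S S' → S'`. Indeed `T'` is the closure of the graph of `β'`, the image
of the irreducible `𝒞'|_{ψ⁻¹U}`, whose generic point goes to the generic point of `S'`.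
[cite: DeJong1996, 4.18, p. 72] -/
theorem range_graphClosureTransportToPullback_subset
    (hι : IsIso (ι ∣_ (pullback.snd f ψ) ⁻¹ᵁ (ψ ⁻¹ᵁ U))) :
    Set.range (h.graphClosureTransportToPullback ψ ι hι) ⊆
      Set.range (strictTransformι (graphClosureMap f p U β h.comm) ψ) := by
  have h' := h.transport ψ ι hι
  haveI := h'.quasiCompact_graphMorphism
  haveI := h'.isIntegral_preimage
  set b := h.graphClosureTransportToPullback ψ ι hι with hb
  set O : (pullback p ψ).Opens := (pullback.snd p ψ) ⁻¹ᵁ (ψ ⁻¹ᵁ U) with hO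
  set t' := toGraphClosure (ι ≫ pullback.snd f ψ) (pullback.snd p ψ) (ψ ⁻¹ᵁ U)
    (transportβ ψ β ι h.isIso h.comm hι) h'.comm with ht'
  -- the generic point of `𝒞'|_{ψ⁻¹U}` goes to the generic point of `S'`
  haveI : IsDominant (pullback.snd p ψ) :=
    (h'.isPointedSemiStableCurve.isSemiStableCurve).isDominant
  haveI : IsDominant O.ι := by
    rw [isDominant_iff, DenseRange, Scheme.Opens.range_ι]
    exact O.2.dense h'.nonempty_preimage
  have e : t' ≫ b ≫ pullback.snd (graphClosureMap f p U β h.comm) ψ = O.ι ≫ pullback.snd p ψ := by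
    rw [hb, graphClosureTransportToPullback_snd, graphClosureMap_def, ht', toGraphClosure_fst_assoc]
  have hξ : b (t' (genericPoint (O : Scheme.{u}))) ∈
      (pullback.snd (graphClosureMap f p U β h.comm) ψ) ⁻¹' {genericPoint S'} := by
    have e' := Scheme.Hom.comp_apply t' (b ≫ pullback.snd (graphClosureMap f p U β h.comm) ψ)
      (genericPoint (O : Scheme.{u}))
    rw [e, Scheme.Hom.comp_apply, Scheme.Hom.comp_apply, genericPoint_eq_of_isDominant O.ι,
      genericPoint_eq_of_isDominant (pullback.snd p ψ)] at e'
    exact e'.symm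
  -- conclude: the range is contained in the closure of that point
  rw [range_strictTransformι]
  have hd : closure (Set.range t') = Set.univ := t'.denseRange.closure_range
  calc Set.range b = b '' closure (Set.range t') := by rw [hd, Set.image_univ]
    _ ⊆ closure (b '' Set.range t') := image_closure_subset_closure_image b.continuous
    _ ⊆ closure ((pullback.snd (graphClosureMap f p U β h.comm) ψ) ⁻¹' {genericPoint S'}) := by
          rw [(isClosed_closure).closure_subset_iff, ← Set.range_comp]
          rintro _ ⟨c, rfl⟩
          have hsp : b (t' (genericPoint (O : Scheme.{u}))) ⤳ b (t' c) :=
            (((genericPoint_spec (O : Scheme.{u})).specializes (Set.mem_univ c)).map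
              t'.continuous).map b.continuous
          exact closure_mono (Set.singleton_subset_iff.mpr hξ) (specializes_iff_mem_closure.mp hsp)

/-- The morphism `T' → T^{st}` to the strict transform of `T` (the lift of
`graphClosureTransportToPullback` through `T^{st} ↪ T ×_S S'`, `T'` being reduced). [folklore] -/
def graphClosureTransportToStrictTransform (hι : IsIso (ι ∣_ (pullback.snd f ψ) ⁻¹ᵁ (ψ ⁻¹ᵁ U))) :
    graphClosure (ι ≫ pullback.snd f ψ) (pullback.snd p ψ) (ψ ⁻¹ᵁ U)
        (transportβ ψ β ι h.isIso h.comm hι) (h.transport ψ ι hι).comm ⟶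
      strictTransform (graphClosureMap f p U β h.comm) ψ :=
  haveI := (h.transport ψ ι hι).quasiCompact_graphMorphism
  haveI := (h.transport ψ ι hι).isIntegral_preimage
  haveI := isReduced_graphClosure _ _ _ _ (h.transport ψ ι hι).comm
  IsClosedImmersion.liftOfRange (strictTransformι (graphClosureMap f p U β h.comm) ψ)
    (h.graphClosureTransportToPullback ψ ι hι) (h.range_graphClosureTransportToPullback_subset ψ ι hι)

/-- `T' → T^{st} ↪ T ×_S S'` is `graphClosureTransportToPullback`. [folklore] -/
@[reassoc (attr := simp)]
theorem graphClosureTransportToStrictTransform_ι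
    (hι : IsIso (ι ∣_ (pullback.snd f ψ) ⁻¹ᵁ (ψ ⁻¹ᵁ U))) :
    h.graphClosureTransportToStrictTransform ψ ι hι ≫ strictTransformι (graphClosureMap f p U β h.comm) ψ =
      h.graphClosureTransportToPullback ψ ι hι := by
  haveI := (h.transport ψ ι hι).quasiCompact_graphMorphism
  haveI := (h.transport ψ ι hι).isIntegral_preimage
  haveI := isReduced_graphClosure _ _ _ _ (h.transport ψ ι hι).comm
  exact IsClosedImmersion.liftOfRange_fac _ _ _

/-- `T' → T^{st} → T` (`strictTransformFst`) is `T' → T`. [folklore] -/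
@[reassoc]
theorem graphClosureTransportToStrictTransform_fst
    (hι : IsIso (ι ∣_ (pullback.snd f ψ) ⁻¹ᵁ (ψ ⁻¹ᵁ U))) :
    h.graphClosureTransportToStrictTransform ψ ι hι ≫ strictTransformFst (graphClosureMap f p U β h.comm) ψ =
      h.graphClosureTransportToGraphClosure ψ ι hι :=
  calc h.graphClosureTransportToStrictTransform ψ ι hι ≫ strictTransformFst (graphClosureMap f p U β h.comm) ψ
      = h.graphClosureTransportToStrictTransform ψ ι hι ≫ strictTransformι (graphClosureMap f p U β h.comm) ψ ≫
          pullback.fst _ _ := rfl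
    _ = h.graphClosureTransportToGraphClosure ψ ι hι := by
          rw [graphClosureTransportToStrictTransform_ι_assoc, graphClosureTransportToPullback_fst]

/-- `T' → T^{st} → S'` (`strictTransformMap`) is `T' → S'`. [folklore] -/
@[reassoc]
theorem graphClosureTransportToStrictTransform_map
    (hι : IsIso (ι ∣_ (pullback.snd f ψ) ⁻¹ᵁ (ψ ⁻¹ᵁ U))) :
    h.graphClosureTransportToStrictTransform ψ ι hι ≫ strictTransformMap (graphClosureMap f p U β h.comm) ψ =
      graphClosureMap _ _ _ _ (h.transport ψ ι hι).comm :=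
  calc h.graphClosureTransportToStrictTransform ψ ι hι ≫ strictTransformMap (graphClosureMap f p U β h.comm) ψ
      = h.graphClosureTransportToStrictTransform ψ ι hι ≫ strictTransformι (graphClosureMap f p U β h.comm) ψ ≫
          pullback.snd _ _ := rfl
    _ = graphClosureMap _ _ _ _ (h.transport ψ ι hι).comm := by
          rw [graphClosureTransportToStrictTransform_ι_assoc, graphClosureTransportToPullback_snd]

/-- The morphism `T^{st} → T'` (the lift of `strictTransformToAmbient` through
`T' ↪ 𝒞' ×_{S'} X'`, `T^{st}` being reduced). [folklore] -/
def strictTransformToGraphClosureTransport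
    (hι : IsIso (ι ∣_ (pullback.snd f ψ) ⁻¹ᵁ (ψ ⁻¹ᵁ U))) (hU : genericPoint S' ∈ ψ ⁻¹ᵁ U) :
    strictTransform (graphClosureMap f p U β h.comm) ψ ⟶
      graphClosure (ι ≫ pullback.snd f ψ) (pullback.snd p ψ) (ψ ⁻¹ᵁ U)
        (transportβ ψ β ι h.isIso h.comm hι) (h.transport ψ ι hι).comm :=
  haveI := h.isReduced_strictTransform_graphClosureMap ψ hU
  IsClosedImmersion.liftOfRange
    (graphClosureι _ _ _ _ (h.transport ψ ι hι).comm) (h.strictTransformToAmbient ψ ι hU)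
    (h.range_strictTransformToAmbient_subset ψ ι hι hU)

/-- `T^{st} → T' ↪ 𝒞' ×_{S'} X'` is `strictTransformToAmbient`. [folklore] -/
@[reassoc (attr := simp)]
theorem strictTransformToGraphClosureTransport_ι
    (hι : IsIso (ι ∣_ (pullback.snd f ψ) ⁻¹ᵁ (ψ ⁻¹ᵁ U))) (hU : genericPoint S' ∈ ψ ⁻¹ᵁ U) :
    h.strictTransformToGraphClosureTransport ψ ι hι hU ≫
        graphClosureι _ _ _ _ (h.transport ψ ι hι).comm =
      h.strictTransformToAmbient ψ ι hU := by
  haveI := h.isReduced_strictTransform_graphClosureMap ψ hU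
  exact IsClosedImmersion.liftOfRange_fac _ _ _

/-- `T' → T^{st} → T'` is the identity (checked on the projections to `𝒞'`, to `X' ↪ X ×_S S'`).
[folklore] -/
theorem graphClosureTransportToStrictTransform_comp
    (hι : IsIso (ι ∣_ (pullback.snd f ψ) ⁻¹ᵁ (ψ ⁻¹ᵁ U))) (hU : genericPoint S' ∈ ψ ⁻¹ᵁ U) :
    h.graphClosureTransportToStrictTransform ψ ι hι ≫ h.strictTransformToGraphClosureTransport ψ ι hι hU =
      𝟙 _ := by
  have h' := h.transport ψ ι hι
  rw [← cancel_mono (graphClosureι _ _ _ _ h'.comm), Category.assoc,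
    strictTransformToGraphClosureTransport_ι, Category.id_comp]
  apply pullback.hom_ext
  · -- to `𝒞' = 𝒞 ×_S S'`
    apply pullback.hom_ext
    · simp only [Category.assoc, strictTransformToAmbient_fst_fst,
        graphClosureTransportToStrictTransform_fst_assoc, graphClosureTransportToGraphClosure_fst]
    · rw [Category.assoc, Category.assoc, strictTransformToAmbient_fst_snd,
        graphClosureTransportToStrictTransform_map]
      rfl
  · -- to `X'`, after `ι`, on the two projections of `X ×_S S'`
    rw [← cancel_mono ι]
    apply pullback.hom_ext
    · simp only [Category.assoc, strictTransformToAmbient_snd_ι_fst,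
        graphClosureTransportToStrictTransform_fst_assoc, graphClosureTransportToGraphClosure_snd]
    · rw [Category.assoc, Category.assoc, Category.assoc, strictTransformToAmbient_snd_ι_snd,
        graphClosureTransportToStrictTransform_map, h.graphClosureMap_transport_def ψ ι hι, Category.assoc,
        pullback.condition]
      simp only [Category.assoc]

/-- `T^{st} → T' → T^{st}` is the identity (checked on the projections to `T ↪ 𝒞 ×_S X` and to
`S'`). [folklore] -/
theorem strictTransformToGraphClosureTransport_comp
    (hι : IsIso (ι ∣_ (pullback.snd f ψ) ⁻¹ᵁ (ψ ⁻¹ᵁ U))) (hU : genericPoint S' ∈ ψ ⁻¹ᵁ U) :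
    h.strictTransformToGraphClosureTransport ψ ι hι hU ≫ h.graphClosureTransportToStrictTransform ψ ι hι =
      𝟙 _ := by
  have h' := h.transport ψ ι hι
  rw [← cancel_mono (strictTransformι (graphClosureMap f p U β h.comm) ψ), Category.assoc,
    graphClosureTransportToStrictTransform_ι, Category.id_comp]
  apply pullback.hom_ext
  · -- to `T`, then to `𝒞 ×_S X`
    rw [Category.assoc, graphClosureTransportToPullback_fst, ← cancel_mono (graphClosureι f p U β h.comm),
      Category.assoc, graphClosureTransportToGraphClosure_ι]
    apply pullback.hom_ext
    · rw [Category.assoc, graphClosureTransportToAmbient_fst, strictTransformToGraphClosureTransport_ι_assoc,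
        strictTransformToAmbient_fst_fst, Category.assoc]
      rfl
    · rw [Category.assoc, graphClosureTransportToAmbient_snd, strictTransformToGraphClosureTransport_ι_assoc,
        strictTransformToAmbient_snd_ι_fst, Category.assoc]
      rfl
  · -- to `S'`
    rw [Category.assoc, graphClosureTransportToPullback_snd, h.graphClosureMap_transport_def ψ ι hι,
      Category.assoc, strictTransformToGraphClosureTransport_ι_assoc, strictTransformToAmbient_fst_snd]
    rfl

/-- **De Jong 1996, 4.18: "the closed subscheme `T' ⊂ 𝒞' ×_{S'} X' ⊂ (𝒞 ×_S X) ×_S S'` is the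
strict transform of `T` with respect to `S' → S`. Therefore, by [22], see 2.19, we may assume
[…] h) […] `T` […] flat over `S`."** For the data of Situation 4.18 transported along `ψ`
(`ThreePointSituation.transport`), the closure `T'` of the graph of `β'` is isomorphic over
`S'` to the strict transform (2.18) of `T → S` along `ψ`
(`graphClosureTransportToStrictTransform`, with inverse `strictTransformToGraphClosureTransport`);
in particular `T' → S'` is flat as soon as that strict transform is flat over `S'` (which 2.19
arranges). [cite: DeJong1996, 4.18, pp. 72–73] -/
theorem flat_graphClosureMap_transport
    (hι : IsIso (ι ∣_ (pullback.snd f ψ) ⁻¹ᵁ (ψ ⁻¹ᵁ U)))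
    [Flat (strictTransformMap (graphClosureMap f p U β h.comm) ψ)] :
    Flat (graphClosureMap (ι ≫ pullback.snd f ψ) (pullback.snd p ψ) (ψ ⁻¹ᵁ U)
      (transportβ ψ β ι h.isIso h.comm hι) (h.transport ψ ι hι).comm) := by
  have h' := h.transport ψ ι hι
  have hU : genericPoint S' ∈ ψ ⁻¹ᵁ U :=
    ((genericPoint_spec S').mem_open_set_iff (ψ ⁻¹ᵁ U).isOpen).mpr (by simpa using h'.nonempty)
  haveI : IsIso (h.graphClosureTransportToStrictTransform ψ ι hι) :=
    ⟨⟨h.strictTransformToGraphClosureTransport ψ ι hι hU,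
      h.graphClosureTransportToStrictTransform_comp ψ ι hι hU,
      h.strictTransformToGraphClosureTransport_comp ψ ι hι hU⟩⟩
  rw [← h.graphClosureTransportToStrictTransform_map ψ ι hι]
  infer_instance

end ThreePointSituation

end GraphStrictTransform

end DeJong1996

/-! ## The assembly: 4.18–4.21 from Raynaud–Gruson's flattening theorem -/

section Assembly

/-- The fibres of a quasi-compact morphism locally of finite type are Noetherian spaces (they are
of finite type over a field). [folklore] -/
theorem noetherianSpace_fiber {X Y : Scheme.{u}} (f : X ⟶ Y) [LocallyOfFiniteType f] [QuasiCompact f]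
    (y : Y) : NoetherianSpace (f.fiber y) := by
  haveI : LocallyOfFiniteType (f.fiberToSpecResidueField y) :=
    MorphismProperty.pullback_snd (P := @LocallyOfFiniteType) _ _ inferInstance
  haveI : IsLocallyNoetherian (f.fiber y) :=
    LocallyOfFiniteType.isLocallyNoetherian (f.fiberToSpecResidueField y)
  haveI : IsNoetherian (f.fiber y) := {}
  infer_instance

/-- If `p|_U = β ≫ f|_U` with `β` an isomorphism and `p` flat over `U`, then `f` is flat over `U`.
[folklore] -/
theorem flat_morphismRestrict_of_iso_comp {C X Y : Scheme.{u}} {p : C ⟶ Y} {f : X ⟶ Y}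
    {U : Y.Opens} (β : ((p ⁻¹ᵁ U : C.Opens) : Scheme.{u}) ⟶ (f ⁻¹ᵁ U : X.Opens)) [IsIso β]
    (hcomm : β ≫ (f ⁻¹ᵁ U).ι ≫ f = (p ⁻¹ᵁ U).ι ≫ p) [Flat (p ∣_ U)] : Flat (f ∣_ U) := by
  have e : f ∣_ U = inv β ≫ p ∣_ U := by
    rw [DeJong1996.morphismRestrict_eq_comp_of_comm β hcomm, IsIso.inv_hom_id_assoc]
  rw [e]
  infer_instance

/-- **The normalisation of a variety is a modification**: finite (E. Noether), hence proper;
birational, being an isomorphism over a non-empty affine open with integrally closed coordinate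
ring. [folklore] -/
theorem isModification_normalizationι (Y : Scheme.{u}) [IsIntegral Y] {k : Type u} [Field k]
    (g : Y ⟶ Spec (.of k)) [LocallyOfFiniteType g] : IsModification (normalizationι Y) := by
  haveI := isFinite_normalizationι Y NoetherFiniteIntegralClosure_holds g
  obtain ⟨W, hW, hWne, hic⟩ := exists_isAffineOpen_isIntegrallyClosed Y NoetherFiniteIntegralClosure_holds g
  haveI := isIso_normalizationι_morphismRestrict Y hW hWne hic
  refine ⟨inferInstance, inferInstance, W, W.2.dense hWne, ?_, inferInstance⟩
  refine (normalizationι Y ⁻¹ᵁ W).2.dense ?_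
  obtain ⟨y, hy⟩ := (normalizationι Y).denseRange.exists_mem_open W.2 hWne
  exact ⟨y, hy⟩

namespace DeJong1996.ThreePointSituation

variable {X S C : Scheme.{u}} [IsIntegral S] {f : X ⟶ S} [LocallyOfFinitePresentation f]
  {n : ℕ} {σ : Fin n → (S ⟶ X)} {p : C ⟶ S} {τ : Fin n → (S ⟶ C)} {U : S.Opens}
  {β : ((p ⁻¹ᵁ U : C.Opens) : Scheme.{u}) ⟶ (f ⁻¹ᵁ U : X.Opens)}

/-- **`T → S` is flat over `U`**: there `T ≅ 𝒞_U` (`pr₁` is an isomorphism over `𝒞_U`) and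
`𝒞 → S` is flat. [cite: DeJong1996, 4.18, p. 72] -/
theorem flat_graphClosureMap_morphismRestrict [IsNoetherian S] (h : ThreePointSituation f σ p τ U β) :
    Flat (graphClosureMap f p U β h.comm ∣_ U) := by
  haveI := h.isSeparated
  haveI := h.quasiCompact_graphMorphism
  haveI := h.isIntegral_preimage
  haveI := h.flat_model
  haveI := (isIso_graphClosureFst_morphismRestrict f p U β h.comm).1
  have h1 : Flat (p ∣_ U) := IsZariskiLocalAtTarget.restrict (P := @Flat) h.flat_model U
  have h2 : Flat (graphClosureFst f p U β h.comm ∣_ p ⁻¹ᵁ U) := inferInstance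
  have e : graphClosureMap f p U β h.comm ∣_ U = (graphClosureFst f p U β h.comm ∣_ p ⁻¹ᵁ U) ≫ (p ∣_ U) :=
    morphismRestrict_comp _ _ _
  rw [e]
  exact MorphismProperty.comp_mem @Flat _ _ h2 h1

/-- **`T` is projective over `k`** when `𝒞` and `X` are (a closed subscheme of `𝒞 ×_S X`, which
is projective by `isProjectiveOver_pullback`). [folklore] -/
theorem isProjectiveOver_graphClosure {k : Type u} [Field k] (h : ThreePointSituation f σ p τ U β)
    (g : S ⟶ Spec (.of k)) [IsSeparated g]
    (hX : Literature.AlgebraicGeometry.Motives.IsProjectiveOver (Over.mk (f ≫ g)))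
    (hC : Literature.AlgebraicGeometry.Motives.IsProjectiveOver (Over.mk (p ≫ g))) :
    Literature.AlgebraicGeometry.Motives.IsProjectiveOver (Over.mk (graphClosureMap f p U β h.comm ≫ g)) := by
  have hP := isProjectiveOver_pullback p g f (f ≫ g) rfl hC hX
  have hw : graphClosureι f p U β h.comm ≫ (Over.mk (pullback.snd p f ≫ f ≫ g) :
      Literature.AlgebraicGeometry.Motives.SchemeOver k).hom =
      (Over.mk (graphClosureMap f p U β h.comm ≫ g) : Literature.AlgebraicGeometry.Motives.SchemeOver k).hom := by
    show graphClosureι f p U β h.comm ≫ pullback.snd p f ≫ f ≫ g = graphClosureMap f p U β h.comm ≫ g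
    rw [graphClosureMap_eq, Category.assoc]
    rfl
  let i : (Over.mk (graphClosureMap f p U β h.comm ≫ g) : Literature.AlgebraicGeometry.Motives.SchemeOver k) ⟶
      Over.mk (pullback.snd p f ≫ f ≫ g) := Over.homMk (graphClosureι f p U β h.comm) hw
  haveI : IsClosedImmersion i.left := inferInstanceAs (IsClosedImmersion (graphClosureι f p U β h.comm))
  exact isProjectiveOver_of_isClosedImmersion_left i hP

end DeJong1996.ThreePointSituation

/-- A strict transform of a projective `X → S → Spec k` along `ψ : S' → S` with `S'` projective is
projective over `k` (a closed subscheme of `X ×_S S'`). [folklore] -/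
theorem isProjectiveOver_strictTransform {k : Type u} [Field k] {X S S' : Scheme.{u}} [IsIntegral S']
    (f : X ⟶ S) (g : S ⟶ Spec (.of k)) [IsSeparated g] (ψ : S' ⟶ S)
    (hX : Literature.AlgebraicGeometry.Motives.IsProjectiveOver (Over.mk (f ≫ g)))
    (hS' : Literature.AlgebraicGeometry.Motives.IsProjectiveOver (Over.mk (ψ ≫ g))) :
    Literature.AlgebraicGeometry.Motives.IsProjectiveOver (Over.mk (strictTransformMap f ψ ≫ ψ ≫ g)) := by
  have hP := isProjectiveOver_pullback f g ψ (ψ ≫ g) rfl hX hS'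
  let i : (Over.mk (strictTransformMap f ψ ≫ ψ ≫ g) : Literature.AlgebraicGeometry.Motives.SchemeOver k) ⟶
      Over.mk (pullback.snd f ψ ≫ ψ ≫ g) := Over.homMk (strictTransformι f ψ) rfl
  haveI : IsClosedImmersion i.left := inferInstanceAs (IsClosedImmersion (strictTransformι f ψ))
  exact isProjectiveOver_of_isClosedImmersion_left i hP

/-- **De Jong 1996, 4.18–4.21 (`DeJong1996RationalMapExtension`) from Raynaud–Gruson's
flattening theorem (`Stacks081R`), everything else PROVED.** Following 4.18: `f` is flat over
`U` (there `X ≅ 𝒞`, which is flat), and so is `T` (there `T ≅ 𝒞`); flatten the strict transform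
of `X` by a projective modification `ψ₁ : S₁ → S` (2.19, `DeJong1996.flattening_of_stacks081R`),
then the strict transform of `T` along `ψ₁` by `ψ₂ : S₂ → S₁` (2.19 again; it is projective over
`k` and flat over `ψ₁⁻¹(U)`), then normalise, `ν : S₃ → S₂` (finite birational, projective);
along the composite modification `ψ = ν ≫ ψ₂ ≫ ψ₁` the strict transforms of `X` and of `T` are
flat ("this condition is also stable under further modifications", `flat_strictTransformMap_comp`,
`flat_strictTransformMap_of_flat`) and `S₃` is normal. The strict transform `X₃ ↪ X ×_S S₃` is a
surjective closed immersion (`surjective_strictTransformι`), an isomorphism over `ψ⁻¹(U)` (2.18),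
from an integral scheme (2.18), and `𝒞 ×_S S₃` is integral (Liu 2002, 4.3.8), so Situation 4.18
transports to `S₃` (`ThreePointSituation.transport`) with `T₃ ≅` the flat strict transform of `T`
(`flat_graphClosureMap_transport`); 4.19–4.21 (`ThreePointSituation.exists_extension'`) give the
extension `β̄ : 𝒞 ×_S S₃ → X₃`, and `β' = β̄ ≫ (X₃ ↪ X ×_S S₃)` is the required morphism.
[cite: DeJong1996, 4.18–4.21, pp. 72–74] -/
theorem DeJong1996RationalMapExtension.of_stacks081R (h081R : Stacks081R.{u}) :
    DeJong1996RationalMapExtension.{u} := by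
  intro k _ X S C _ _ _ f _ _ g n σ p τ U β hσ hpt hS hX hC hcf h3 hUne hβ hcomm hfac
  haveI := hβ
  -- instances carried by the data
  haveI : IsProper g :=
    Literature.AlgebraicGeometry.Motives.IsProjectiveOver.isProper (X := Over.mk g) hS
  haveI : IsLocallyNoetherian S := LocallyOfFiniteType.isLocallyNoetherian g
  haveI : CompactSpace S := QuasiCompact.compactSpace_of_compactSpace g
  haveI : IsNoetherian S := {}
  haveI : Surjective f := hcf.surjective
  haveI : IsDominant f := ⟨f.surjective.denseRange⟩
  have hsst := hpt.isSemiStableCurve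
  haveI : Flat p := hsst.flat
  haveI : IsProper p := hsst.isProper
  have hηU : genericPoint S ∈ U :=
    ((genericPoint_spec S).mem_open_set_iff U.isOpen).mpr (by simpa using hUne)
  -- Situation 4.18
  have H : DeJong1996.ThreePointSituation f σ p τ U β :=
    { isIntegral := ‹_›
      isProper := ‹_›
      comp_eq_id := hσ
      isCurveFibration := hcf
      hasThreeSmoothPoints := h3
      isIntegral_model := ‹_›
      isPointedSemiStableCurve := hpt
      nonempty := hUne
      isIso := hβ
      comm := hcomm
      fac := hfac }
  -- `f` and `T → S` are flat over `U`; `T` is projective over `k`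
  haveI : Flat (p ∣_ U) := IsZariskiLocalAtTarget.restrict (P := @Flat) H.flat_model U
  have hflatU : Flat (f ∣_ U) := flat_morphismRestrict_of_iso_comp β hcomm
  have hflatT : Flat (DeJong1996.graphClosureMap f p U β H.comm ∣_ U) :=
    H.flat_graphClosureMap_morphismRestrict
  have hTproj := H.isProjectiveOver_graphClosure g hX hC
  -- Stage 1 (2.19): flatten the strict transform of `X`
  obtain ⟨S₁, hS₁int, ψ₁, hS₁proj, hmod₁, -, hflat₁⟩ :=
    DeJong1996.flattening_of_stacks081R h081R k X S f g U hS hX hUne hflatU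
  haveI := hS₁int
  haveI := hflat₁
  haveI : IsProper ψ₁ := hmod₁.isProper
  haveI : Surjective ψ₁ := hmod₁.isAlteration.surjective
  -- Stage 2 (2.19): flatten the strict transform of `T` along `ψ₁`
  have hU₁ne : ((ψ₁ ⁻¹ᵁ U : S₁.Opens) : Set S₁).Nonempty := by
    obtain ⟨s, hs⟩ := hUne
    obtain ⟨s₁, rfl⟩ := ψ₁.surjective s
    exact ⟨s₁, hs⟩
  have hflatT₁ : Flat (strictTransformMap (DeJong1996.graphClosureMap f p U β H.comm) ψ₁ ∣_ ψ₁ ⁻¹ᵁ U) :=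
    flat_strictTransformMap_morphismRestrict _ ψ₁ U hflatT
  have hT₁proj := isProjectiveOver_strictTransform (DeJong1996.graphClosureMap f p U β H.comm) g ψ₁
    hTproj hS₁proj
  obtain ⟨S₂, hS₂int, ψ₂, hS₂proj, hmod₂, -, hflat₂⟩ :=
    DeJong1996.flattening_of_stacks081R h081R k _ S₁
      (strictTransformMap (DeJong1996.graphClosureMap f p U β H.comm) ψ₁) (ψ₁ ≫ g) (ψ₁ ⁻¹ᵁ U)
      hS₁proj hT₁proj hU₁ne hflatT₁
  haveI := hS₂int
  haveI := hflat₂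
  haveI : IsProper ψ₂ := hmod₂.isProper
  haveI : Surjective ψ₂ := hmod₂.isAlteration.surjective
  -- Stage 3: normalise the base
  haveI : IsProper (ψ₂ ≫ ψ₁ ≫ g) :=
    Literature.AlgebraicGeometry.Motives.IsProjectiveOver.isProper (X := Over.mk (ψ₂ ≫ ψ₁ ≫ g)) hS₂proj
  have hmodν : IsModification (normalizationι S₂) := isModification_normalizationι S₂ (ψ₂ ≫ ψ₁ ≫ g)
  have hS₃proj := isProjectiveOver_normalization (ψ₂ ≫ ψ₁ ≫ g) hS₂proj
  haveI : IsProper (normalizationι S₂) := hmodν.isProper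
  haveI : Surjective (normalizationι S₂) := hmodν.isAlteration.surjective
  -- the composite modification `ψ : S₃ → S`
  set ψ := normalizationι S₂ ≫ ψ₂ ≫ ψ₁ with hψ
  have hmod : IsModification ψ := hmodν.comp (hmod₂.comp hmod₁)
  haveI : IsProper ψ := hmod.isProper
  haveI : Surjective ψ := hmod.isAlteration.surjective
  haveI : IsDominant ψ := hmod.isDominant
  haveI : IsProper (ψ ≫ g) := inferInstance
  haveI : IsLocallyNoetherian (normalization S₂) := LocallyOfFiniteType.isLocallyNoetherian (ψ ≫ g)
  haveI : CompactSpace (normalization S₂) := QuasiCompact.compactSpace_of_compactSpace (ψ ≫ g)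
  haveI : IsNoetherian (normalization S₂) := {}
  have hUψne : ((ψ ⁻¹ᵁ U : (normalization S₂).Opens) : Set (normalization S₂)).Nonempty := by
    obtain ⟨s, hs⟩ := hUne
    obtain ⟨s₃, rfl⟩ := ψ.surjective s
    exact ⟨s₃, hs⟩
  -- h): the strict transforms of `X` and `T` along `ψ` are flat
  have hflatX : Flat (strictTransformMap f ψ) := by
    haveI : Flat (strictTransformMap (strictTransformMap f ψ₁) (normalizationι S₂ ≫ ψ₂)) :=
      flat_strictTransformMap_of_flat (normalizationι S₂ ≫ ψ₂) (strictTransformMap f ψ₁)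
    have hne : ((((normalizationι S₂ ≫ ψ₂) ≫ ψ₁) ⁻¹ᵁ U : (normalization S₂).Opens) :
        Set (normalization S₂)).Nonempty := by rwa [Category.assoc]
    have := flat_strictTransformMap_comp f ψ₁ (normalizationι S₂ ≫ ψ₂) U hne hflatU
    rwa [Category.assoc] at this
  have hflatTψ : Flat (strictTransformMap (DeJong1996.graphClosureMap f p U β H.comm) ψ) := by
    have hne₂ : (((ψ₂ ≫ ψ₁) ⁻¹ᵁ U : S₂.Opens) : Set S₂).Nonempty := by
      obtain ⟨s, hs⟩ := hU₁ne
      obtain ⟨s₂, rfl⟩ := ψ₂.surjective s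
      exact ⟨s₂, hs⟩
    haveI : Flat (strictTransformMap (DeJong1996.graphClosureMap f p U β H.comm) (ψ₂ ≫ ψ₁)) :=
      flat_strictTransformMap_comp _ ψ₁ ψ₂ U hne₂ hflatT
    haveI : Flat (strictTransformMap
        (strictTransformMap (DeJong1996.graphClosureMap f p U β H.comm) (ψ₂ ≫ ψ₁)) (normalizationι S₂)) :=
      flat_strictTransformMap_of_flat (normalizationι S₂) _
    exact flat_strictTransformMap_comp _ (ψ₂ ≫ ψ₁) (normalizationι S₂) U hUψne hflatT
  -- i): `S₃` is normal
  have hS₃ : ∀ s : normalization S₂, IsIntegrallyClosed ((normalization S₂).presheaf.stalk s) :=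
    isIntegrallyClosed_stalk_normalization S₂
  -- the strict transform `X₃ ↪ X ×_S S₃`: surjective, integral, an isomorphism over `ψ⁻¹(U)`
  haveI : ∀ y : S, NoetherianSpace ↥(f.fiber y) := fun y => noetherianSpace_fiber f y
  haveI : ∀ y' : normalization S₂, NoetherianSpace ↥((pullback.snd f ψ).fiber y') := fun y' =>
    noetherianSpace_fiber _ y'
  haveI : Surjective (strictTransformι f ψ) := surjective_strictTransformι f ψ hcf.dense_preimage_smoothLocus
  haveI : IsIntegral (strictTransform f ψ) :=
    (DeJong1996StrictTransformModification_holds X S (normalization S₂) f ψ hmod).isIntegral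
  have hι : IsIso (strictTransformι f ψ ∣_ (pullback.snd f ψ) ⁻¹ᵁ (ψ ⁻¹ᵁ U)) :=
    DeJong1996StrictTransformFlatLocus_holds X S (normalization S₂) f ψ U hflatU
  haveI : LocallyOfFinitePresentation (strictTransformι f ψ ≫ pullback.snd f ψ) := inferInstance
  -- `𝒞 ×_S S₃` is integral (Liu 2002, 4.3.8; `𝒞` is smooth over the open of 4.17)
  obtain ⟨V, hηV, hVsm⟩ :=
    Literature.AlgebraicGeometry.Morphisms.exists_smooth_morphismRestrict_of_smooth_fiber_genericPoint f
      hcf.smooth_fiberToSpecResidueField_genericPoint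
  haveI := hVsm
  haveI : Smooth (f ∣_ (V ⊓ U)) := smooth_morphismRestrict_of_le f inf_le_left
  haveI : Smooth (p ∣_ (V ⊓ U)) := smooth_morphismRestrict_of_iso_comp β hcomm inf_le_right
  have hWne : ((V ⊓ U : S.Opens) : Set S).Nonempty := ⟨genericPoint S, hηV, hηU⟩
  have hpre := hpt.preSemiStablePair_of_smooth (g := g) hC hS hWne
  haveI : IsIntegral (pullback p ψ) := hpre.isIntegral_pullback_of_liu Liu2002IntegralOfFlat_holds ψ
  -- transport Situation 4.18 to `S₃` and apply 4.19–4.21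
  have H₃ := H.transport ψ (strictTransformι f ψ) hι
  have hT₃ := H.flat_graphClosureMap_transport ψ (strictTransformι f ψ) hι
  have hX₃ : Flat (strictTransformι f ψ ≫ pullback.snd f ψ) := hflatX
  obtain ⟨βbar, hcomp, hres, hisoβ, hsecβ⟩ := H₃.exists_extension' hS₃ hX₃ hT₃
  -- the output
  refine ⟨normalization S₂, inferInstance, ψ, βbar ≫ strictTransformι f ψ, hmod, ?_, ?_, ?_, ?_, ?_⟩
  · simpa only [hψ, Category.assoc] using hS₃proj
  · rw [Category.assoc]
    exact hcomp
  · rw [morphismRestrict_comp]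
    have h1 : IsIso (βbar ∣_ (strictTransformι f ψ) ⁻¹ᵁ ((pullback.snd f ψ) ⁻¹ᵁ (ψ ⁻¹ᵁ U))) := hisoβ
    exact @IsIso.comp_isIso _ _ _ _ _ _ _ h1 hι
  · intro i
    rw [← Category.assoc, hsecβ i, DeJong1996.StrictTransform.sect_ι]
  · -- `β'` restricts to the base change of `β` over `U`
    have hO : (pullback.fst p ψ) ⁻¹ᵁ (p ⁻¹ᵁ U) = (pullback.snd p ψ) ⁻¹ᵁ (ψ ⁻¹ᵁ U) := by
      rw [← Scheme.Hom.comp_preimage, pullback.condition, Scheme.Hom.comp_preimage]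
    have e1 : ((pullback.fst p ψ) ⁻¹ᵁ (p ⁻¹ᵁ U)).ι =
        ((pullback p ψ).isoOfEq hO).hom ≫ ((pullback.snd p ψ) ⁻¹ᵁ (ψ ⁻¹ᵁ U)).ι :=
      (Scheme.isoOfEq_hom_ι _ _).symm
    have e2 : pullback.fst p ψ ∣_ p ⁻¹ᵁ U = ((pullback p ψ).isoOfEq hO).hom ≫
        (pullback.fst p ψ).resLE (p ⁻¹ᵁ U) ((pullback.snd p ψ) ⁻¹ᵁ (ψ ⁻¹ᵁ U))
          (DeJong1996.preimage_snd_le_preimage_fst p ψ U) := by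
      rw [← cancel_mono (p ⁻¹ᵁ U).ι, morphismRestrict_ι, Category.assoc, Scheme.Hom.resLE_comp_ι,
        Scheme.isoOfEq_hom_ι_assoc]
    rw [e1, e2, Category.assoc, Category.assoc, Category.assoc, reassoc_of% hres,
      DeJong1996.transportβ_ι_ι_fst]

/-- **4.18–4.21 with the transport of (vi) f), g) (`DeJong1996ThreePointExtension`) from
`Stacks081R`.** [cite: DeJong1996, 4.16–4.22, pp. 71–74] -/
theorem DeJong1996ThreePointExtension.of_stacks081R (h081R : Stacks081R.{u}) :
    DeJong1996ThreePointExtension.{u} :=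
  DeJong1996ThreePointExtension.of_rationalMapExtension (DeJong1996RationalMapExtension.of_stacks081R h081R)

/-- **4.18–4.21 with the first two sentences of 4.22 (`DeJong1996ModelExtensionReduction`) from
`Stacks081R`** (4.15, `DeJong1996StrictTransform_holds`, being proved): the node 4.18–4.22a of the
decomposition of de Jong's Thm. 4.1 now rests on Raynaud–Gruson's flattening theorem alone.
[cite: DeJong1996, 4.15–4.22, pp. 71–74] -/
theorem DeJong1996ModelExtensionReduction.of_stacks081R (h081R : Stacks081R.{u}) :
    DeJong1996ModelExtensionReduction.{u} :=
  DeJong1996ModelExtensionReduction.of_rationalMapExtension_of_strictTransform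
    (DeJong1996RationalMapExtension.of_stacks081R h081R) DeJong1996StrictTransform_holds

/-- `DeJong1996StableModelToMorphism` from `Stacks081R`. [cite: DeJong1996, 4.15–4.22, pp. 71–74] -/
theorem DeJong1996StableModelToMorphism.of_stacks081R (h081R : Stacks081R.{u}) :
    DeJong1996StableModelToMorphism.{u} :=
  DeJong1996StableModelToMorphism.of_rationalMapExtension_of_strictTransform
    (DeJong1996RationalMapExtension.of_stacks081R h081R) DeJong1996StrictTransform_holds

/-- `DeJong1996StableModelToPreSemiStablePair` (4.18–4.22a) from `Stacks081R`.
[cite: DeJong1996, 4.15–4.22, pp. 71–74] -/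
theorem DeJong1996StableModelToPreSemiStablePair.of_stacks081R (h081R : Stacks081R.{u}) :
    DeJong1996StableModelToPreSemiStablePair.{u} :=
  DeJong1996StableModelToPreSemiStablePair.of_rationalMapExtension_of_strictTransform
    (DeJong1996RationalMapExtension.of_stacks081R h081R) DeJong1996StrictTransform_holds

end Assembly

end Literature.AlgebraicGeometry.Resolution

end
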